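import Literature.MathematicalPhysics.QuantumFieldTheory.Balaban1983to89.Node00.Record13SepCoP
import Literature.MathematicalPhysics.QuantumFieldTheory.Balaban1983to89.Node00.Record13DatumKeyCoP

/-!
# NODE 00 (YM-PLAN Track A) — THE STAGE-13 DATUM ∕ RECORD KEYS RE-KEYED ON THE PROVISOS OF RECORD `Stage13Params.Provisos₁₃SepCoP` (def-T `Node00/Record13SepCoP` = RECORD 13 v1.5, FILE 24T):
# `IsDatumOfRecord₁₃CSepCoP` (+ `.params ∕ .provisos`, `canon₁₃SepCoP`, `IsRateKey₁₃SepCoP`), the regime keys `IsDatumOfRecord₁₃CSepCoPOn ∕ IsRecordOfRecord₁₃CSepCoPOn ∕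
# canon₁₃SepCoPOn`, the CN keys at the guard of record `IsDatumOfRecord₁₃CSepCoPN ∕ IsRecordOfRecord₁₃CSepCoPN`, and the one-way bridges INTO the CORE-keyed classes of the same edition,
# `Node00/Record13DatumKeyCoP` (§8)

NODE 00 RECORD MODULE (cell `pub-ymgap`, seat `pub-ymgap-node00-def-RR-2` gen 12 = second reader ∕ key + instance side of the RATE-RECORD HOME, director-ym R141 (A);
dag-lead «datum-KEY twin leaf = RR-2 lineage, one declarer»).  THE `SepCoP` TWIN of this seat's `Node00/Record13DatumKey` (the Stage-13 datum ∕ record keys over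
`Stage13Params.Provisos₁₃`, v1.1 of def-T's `Node00/Record13`; «‴»), RE-KEYED on the proviso predicate of RECORD 13 v1.5 — def-T's SIBLING module `Node00/Record13SepCoP` (FILE 24T, same namespace) —
exactly as this seat's `Node00/Record13DatumKeySep` («⁗») re-keyed it on v1.2 §9's `Provisos₁₃Sep`, `Node00/Record13DatumKeySepMixed` on v1.3's `Provisos₁₃SepMixed` and
`Node00/Record13DatumKeySepCo` on v1.4's `Provisos₁₃SepCo`; equivalently, the `SepCo ↦ SepCoP, Co ↦ CoP` image of that v1.4 leaf (its 112 declarations map onto the 112 below ONE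
FOR ONE, statement AND proof — checked byte for byte against the landed file before filing).  WHY A FOURTH TWIN (director-ym LINE №160 «RULING ON LOCATED-7: FINDING №7 REAL,
class «record other than print»; FIX SHAPE F7» + LINE №162 «(y) FINAL: HOLD-ALL; rev 20 keys ONCE on v1.5 `CoP`; EDITION FREEZE»; def-T F7-a `Node00/TkWeightsOfRecordP`,
node00-def-R F7-b `Node00/LargeFieldBackgroundCoPOfRecord`, def-T F7-c FILE 23 `Node00/Record13CoP` + FILE 24T `Node00/Record13SepCoP`): the v1.4 CLASS EDITION (`Co ∕ SepCo`;
background = print's own minimiser over [15]'s class (6) = (1.7) ∧ (1.9), director-ym №152 (β) — itself the cure of v1.3's starved `h9` row) still read RECORD 13's 𝐓-weights with a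
small-field cut χ_reg ON the resummed region (12a `zetaWt = zetaWtP · chiRegW`) and ranged the scale-0 clauses of the regular class, of (1.9) and of the data-regularity (7) over
the WHOLE torus, where print charges the large plaquette variables outside the support to ζ's resummed factors and asks regularity on the collar only ([III] (1.1) p.246,
(1.10)–(1.12) p.248, p.255, p.256; [15] p.277 (1), p.278 (2)–(5)) — FINDING №7, located at the 12a ∕ 11a junction (def-T LOCATED-7, ref-H).  The cure ruled (№160 F7) is the
v1.5 `CoP` EDITION, re-seeding BOTH cones of RECORD 13: (F7-a) print's weights `zetaWtP := Z.ζ0 j Y` ∕ `tkWeightsOfRecordP` (no χ_reg factor; [III] (1.11) p.248); (F7-b)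
node00-def-R's SUPPORT EDITION of the class and the background, `regMSCoPOfRecord ∕ bgMSCoPOfRecord ∕ UbgMSCoPOfRecord ∕ regSuppPOfRecord` (the scale-0 clauses re-ranged to
print's Ω₀ = Ω₁ plus one layer of M₁-cubes); (F7-c) def-T's RECORD 13 re-generated at those two seeds, token for token (KEY-RULE-21 R1–R6, tables KEY-23 ∕ KEY-24T):
`Node00/Record13CoP` (the §2 form, 𝐑-leaf, residual `Stage13Params.toStage5₁₃CoP`, background `UbgOfRecord₁₃CoP`, core, tower and datum `towerOfRecord₁₃CoP ∕ datumOfRecord₁₃CoP`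
over the bg-free `Provisos₁₃Core` — NOT re-issued, token-identical — and `IsRecordOfRecord₁₃CCoP`) and `Node00/Record13SepCoP` (the proviso structure OF RECORD
`Stage13Params.Provisos₁₃SepCoP` = `Provisos₁₃SepCo`'s rows, field order and pins verbatim — `toProvisos₁₃Core`, `hM`, `hM₁`, `bg` AT `UbgOfRecord₁₃CoP` over the support
`suppOfRecord₁₃SepCoP` — with the faces `.toCore ∕ .odd_M ∕ .not_four_dvd_M ∕ .M₁_dvd_dCubeSide ∕ .tstep`; tower and datum `towerOfRecord₁₃SepCoP ∕ datumOfRecord₁₃SepCoP` = the core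
ones at `h.toCore` (`datumOfRecord₁₃SepCoP_eq_coP`, `rfl`), so the `bg` row and the §2 form read the SAME background; the record predicate `IsRecordOfRecord₁₃CSepCoP` (+ `.toCoP`)).
v1.3 (`SepMixed`) and v1.4 (`Co ∕ SepCo`) stay in the tree as landed siblings with their key leaves and storeys (settled helper leaves, №160 (5)); v1.5 is the LAST edition before
the items are keyed (№160 (4) EDITION FREEZE) and the route's Stage-13 items are re-filed (rev 20) ONCE, on the v1.5 names ONLY: `Stage13Params ∕ θ.Provisos₁₃SepCoP ∕
datumOfRecord₁₃SepCoP ∕ IsRecordOfRecord₁₃CSepCoP` and their faces, read from def-T's record files directly (the K texts name none of this seat's key classes — this leaf serves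
the closing roads, not the item texts).  This module is the same token map applied to `Node00/Record13DatumKey`: EVERY declaration of §1–§7 below is the v1.1-keyed declaration with `Provisos₁₃ ↦
Provisos₁₃SepCoP`, `datumOfRecord₁₃ ↦ datumOfRecord₁₃SepCoP`, `IsRecordOfRecord₁₃C… ↦ IsRecordOfRecord₁₃CSepCoP…` in its statement and proof, under the NAME RULE «def-T's
suffix `SepCoP` at def-T's position»: `IsDatumOfRecord₁₃C ↦ IsDatumOfRecord₁₃CSepCoP`, `IsDatumOfRecord₁₃COn ↦ IsDatumOfRecord₁₃CSepCoPOn`, `IsDatumOfRecord₁₃CN ↦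
IsDatumOfRecord₁₃CSepCoPN`, `IsRecordOfRecord₁₃COn ∕ CN ↦ IsRecordOfRecord₁₃CSepCoPOn ∕ CSepCoPN`, `canon₁₃ ↦ canon₁₃SepCoP`, `canon₁₃On ↦ canon₁₃SepCoPOn`, `IsRateKey₁₃ ↦
IsRateKey₁₃SepCoP`, the theorem stems likewise (`isDatumOfRecord₁₃CSepCoP_datumOfRecord₁₃SepCoP`, `exists_keyed_canon₁₃SepCoP_iff`, `keyed_canon₁₃SepCoPOn_coherent`,
`forall_isRecordOfRecord₁₃CSepCoPN_iff`, …) — equivalently, the ⁗ module with `CSep ↦ CSepCoP`, `canon₁₃Sep ↦ canon₁₃SepCoP`, `IsRateKey₁₃Sep ↦ IsRateKey₁₃SepCoP` (and `toStage5₁₃ ↦ toStage5₁₃CoP`).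
KEYED FLAT on `datumOfRecord₁₃SepCoP` (the token the rev-20 item texts carry; def-T's `datumOfRecord₁₃SepCoP_eq_coP` (`rfl`) reaches the v1.5 core datum `datumOfRecord₁₃CoP`, on
which the rate ∕ spine HOMES are keyed once: this seat's `Node00/Record13DatumKeyCoP`).  APPEND-ONLY: a NEW leaf importing this seat's `Node00/Record13DatumKeyCoP` (hence
`Node00/Record13DatumKey`, def-T's `Node00/Record13CoP ∕ Record13`) and def-T's `Node00/Record13SepCoP` (hence node00-def-R's `Node00/LargeFieldBackgroundCoPOfRecord` and the
`bg`-row readers' modules it imports); NOTHING landed is edited — the ‴, ⁗, `SepMixed`, `Co`, `SepCo` and `CoP` key modules stand VERBATIM.  CONSUMED BY NAME from def-T's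
`Node00/Record13SepCoP` (v1.5): `Stage13Params.Provisos₁₃SepCoP`,
`Stage13Params.Provisos₁₃SepCoP.toCore`, `datumOfRecord₁₃SepCoP`, `datumOfRecord₁₃SepCoP_eq_coP`, `IsRecordOfRecord₁₃CSepCoP` (+ `.toCoP`),
`exists_world_isRecordOfRecord₁₃CSepCoP`, `exists_provisos_of_isRecordOfRecord₁₃CSepCoP`, `exists_isRecordOfRecord₅C_of_isRecordOfRecord₁₃CSepCoP`, the `rfl` faces
`βfun_ ∕ flow_g_ ∕ av_ ∕ isDatumOfRecord₀_datumOfRecord₁₃SepCoP`, `isPrintedAveraged_datumOfRecord₁₃SepCoP`; REUSED BY NAME from `Node00/Record13DatumKey` (θ-level,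
proviso-free — NOT twinned): the residual-assignment types and lifts `RateAssignment₁₃ ∕ SpineAssignment₁₃` (`.ofStageFree ∕ .of₁₁ ∕ .of₁₂ ∕ .toStageFree`,
`rateAssignment₁₃OfStageFree ∕ Of₁₁ ∕ Of₁₂`, `spineAssignment₁₃OfStageFree ∕ Of₁₁ ∕ Of₁₂`) and the guard of record `unityNondeg₁₃ ∕ unityNondeg₁₃_iff`.  The key layer is
PROVISO-FIELD-BLIND (no declaration here projects a field of `Provisos₁₃SepCoP`; the `bg` row over the CoP background is read only by def-T's `norm_E_bg_le_stage13SepCoP` and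
the (B)-side closers), which is why the re-key is a token map and every proof term of §1–§7 is the v1.1 proof term.

WHY THIS OBJECT (as at v1.1 ∕ v1.2 ∕ v1.3; said once more for the `SepCoP` reader).  The rate-record home and the spine-record home of clusters K4 ∕ K5 are read JOINTLY by the N19′
edge, so both are keyed to ONE parameter per datum: THE CANONICAL PARAMETER `h.params := Classical.choose h` of `h : IsDatumOfRecord₁₃CSepCoP F N D`, with `h.provisos :
h.params.Provisos₁₃SepCoP F N`, `h.admissible`, `h.eq_datumOfRecord₁₃SepCoP : D = datumOfRecord₁₃SepCoP F N h.params h.provisos`; every θ-level object of record then has ONE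
datum-level instance per `(F, D, g₀, os)`, records keyed «`∃ θ hP, θ.Admissible F N ∧ D = datumOfRecord₁₃SepCoP F N θ hP ∧ S = canon₁₃SepCoP F N cr θ hP g₀ os`» are
COHERENT (`exists_keyed_canon₁₃SepCoP_iff`, `keyed_canon₁₃SepCoP_coherent`), and a consumer proving its node at EVERY admissible tuple with (v1.5) provisos proves it at the datum
(`IsDatumOfRecord₁₃CSepCoP.forall_params`).  `isDatumOfRecord₁₃CSepCoP_iff_exists_world`: the datum class IS def-T's `IsRecordOfRecord₁₃CSepCoP` with the world
forgotten; «`∃ D w, IsRecordOfRecord₁₃CSepCoP F N D w`» REDUCES HONESTLY to «one admissible Stage-13 tuple with every field of `Provisos₁₃SepCoP` a theorem»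
(`exists_isDatumOfRecord₁₃CSepCoP_iff_exists_params`) — INHABITATION IS NOT CLAIMED HERE.  `IsRateKey₁₃SepCoP F N D w θ` is `IsRecordOfRecord₁₃CSepCoP`'s body with θ
EXPOSED (`isRecordOfRecord₁₃CSepCoP_iff_exists_isRateKey₁₃SepCoP`, `Iff.rfl`).  THE REGIME KEYS (§4–§6): a reading that CONSUMES a regime `Rg : (F : T4Family) →
Stage13Params F N → Prop` quantifies over `IsDatumOfRecord₁₃CSepCoPOn F N Rg D` ∕ `IsRecordOfRecord₁₃CSepCoPOn F N Rg D w` (canonical parameter IN the regime, `h.regime`;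
junction `forall_isRecordOfRecord₁₃CSepCoPOn_iff`; `canon₁₃SepCoPOn Rg` with COHERENCE).  §7 instantiates the CN keys at the guard of record `unityNondeg₁₃ N F θ := θ.ZtUnity F N
∧ θ.SlotsNondegenerate₁₃ F N` with the literal faces `isDatumOfRecord₁₃CSepCoPN_iff`, `exists_isDatumOfRecord₁₃CSepCoPN_iff_exists_params` (= the body «`∃ θ, θ.Provisos₁₃SepCoP
F N ∧ (θ.ZtUnity F N ∧ θ.SlotsNondegenerate₁₃ F N) ∧ θ.Admissible F N`» a rev-20 inhabitation item reads at `(F, 2)`) and `forall_isRecordOfRecord₁₃CSepCoPN_iff` (= the guarded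
∀-items' binder prefix `∀ (θ) (h : θ.Provisos₁₃SepCoP F N), (θ.ZtUnity F N ∧ θ.SlotsNondegenerate₁₃ F N) → θ.Admissible F N → … (datumOfRecord₁₃SepCoP F N θ h) …`).  At the
trivial regime everything is the CSepCoP key again (`isDatumOfRecord₁₃CSepCoPOn_true_iff`, `isRecordOfRecord₁₃CSepCoPOn_true_iff`).

§8 THE ONE-WAY BRIDGE SepCoP → CoP (INTO `Node00/Record13DatumKeyCoP`), AND WHY THERE IS NO OTHER.  `Provisos₁₃SepCoP → Provisos₁₃Core` IS a lemma (def-T's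
`Provisos₁₃SepCoP.toCore`: forget the background-field row, every other row verbatim) and `datumOfRecord₁₃CoP F N θ hP.toCore` IS `datumOfRecord₁₃SepCoP F N θ hP`
DEFINITIONALLY (def-T's `datumOfRecord₁₃SepCoP_eq_coP`, `rfl`; used by unification), so every v1.5-keyed class implies its `CoP` twin AT THE SAME DATUM AND PARAMETER, one
argument each: `IsRateKey₁₃SepCoP.toCoP`, `IsDatumOfRecord₁₃CSepCoP.toCoP`, `IsDatumOfRecord₁₃CSepCoPOn.toCoP`, `IsRecordOfRecord₁₃CSepCoPOn.toCoP`, `IsDatumOfRecord₁₃CSepCoPN.toCoP`,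
`IsRecordOfRecord₁₃CSepCoPN.toCoP` (the record-level `IsRecordOfRecord₁₃CSepCoP.toCoP` is def-T's).  Use: a rate ∕ spine HOME keyed ONCE on `IsRecordOfRecord₁₃CCoP[On]` ∕
`datumOfRecord₁₃CoP` is applied at a rev-20 item's tuple `(θ, h : θ.Provisos₁₃SepCoP F N)` as `… θ h.toCore …`, the datum by `rfl`; NO converse (`Provisos₁₃Core → Provisos₁₃SepCoP`
would assert a background-field bound from nothing).  NO bridge between the `SepCoP` keys and the ‴ ∕ ⁗ ∕ `SepMixed` ∕ `Co` ∕ `SepCo` keys IN EITHER DIRECTION: their data of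
record are generated at DIFFERENT seeds (`UbgOfRecord₁₃` = the (1.7)-class minimiser on the torus, `UbgOfRecord₁₃Co` = the (6)-class one on the torus, both with the cut weights;
`UbgOfRecord₁₃CoP` = the (6)-class one on the support Ω₀, with print's uncut weights), the backgrounds comparable at most through [15] Thm 1's uniqueness modulo gauge, which is
NOT asserted anywhere in the tree, and the densities differing by the dropped cut outright; the four older editions' keys and the classes of this module are not connected by any
bridge.

WHAT IS NOT HERE.  NO edit of any landed key module or consumer; NO `SepCoP ↔ ‴ ∕ ⁗ ∕ SepMixed ∕ Co ∕ SepCo` bridge (see §8); NO `CoP → SepCoP` bridge; NO `₁₂ ↔ ₁₃` key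
bridge; NO reading of the `bg` row, of the 𝐓-weights, of the Co-class or of print's (7) clause; NO inhabitant of any key; the θ-level assignments and the guard of record are NOT re-declared (imported by name).

HONEST FRAMING.  Definitions of record + kernel bookkeeping (`Classical.choose`, `rfl`, `dite`, ∃-repackaging); NOTHING of Bałaban's is asserted; NO inhabitant of any key
is claimed (the record's inhabitation item is OPEN); no node is discharged; counts unmoved (COUNT-NEUTRAL); one finite four-torus programme at fixed `ε` — NOT the
continuum limit on ℝ⁴, NOT infinite volume, NOT OS, NOT a mass gap, NOT the Clay problem.  No `sorry` ∕ `axiom` ∕ `opaque` ∕ `instance` ∕ `notation`.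
[Balaban1989LargeFieldII] = Commun. Math. Phys. **122** (1989) 355–392; [III] = [Balaban1988Convergent] = Commun. Math. Phys. **119** (1988) 243–285 ((1.1) p.246, (1.10)–(1.12)
p.248: print's ζ_j(Y) and the constraint; p.255: the support; p.256: «V_{j−1} regular on Γ_{j−1}»; p.257: partition compatibility); [Balaban1988RG2Cluster] = Commun. Math. Phys.
**116** (1988) 1–22 ((2.18): separated sequences); [Balaban1987RG1] = Commun. Math. Phys. **109** (1987) 249–301; [15] = [Balaban1985Variational] = Commun. Math. Phys. **102**
(1985) 277–309 ((1)–(3), (5)–(8) pp.277–280: the domains Ω_j ⊆ Ω₀, the regular ∕ co-divergent classes, the `V ∕ V̄` mixed plaquette rule (7), and Thm 1's minimiser); [6] =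
[Balaban1985RegularSpaces] = Commun. Math. Phys. **99** (1985) 75–102 — [15] and [6] cited for orientation only, nothing of them asserted (ERRATUM to the v1.4 leaves' headers,
which printed «[15] = [Balaban1985RegularSpaces] = CMP 102»: the CMP-102 paper is [Balaban1985Variational]; docstring only, nothing keyed on it).
-/

noncomputable section

namespace Literature.MathematicalPhysics.QuantumFieldTheory.Balaban1983to89.Node00

open T4Continuum AveragingRT T4FiniteEpsInhabited FlowStep FlowStepRuns DagBinding T4DatumAssembly

/-! ## §1. «`D` is a datum of record, Stage 13» and its CANONICAL parameter -/

section DatumKey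

variable (F : T4Family) (N : ℕ) [NeZero N]

/-- **«`D` is a datum of record, Stage 13 (C-class)»**: SOME admissible Stage-13 parameter tuple satisfying its displayed provisos has `D` as its datum of record — the
datum-level shadow of `IsRecordOfRecord₁₃CSepCoP` (the world forgotten; `isDatumOfRecord₁₃CSepCoP_iff_exists_world`). [cite: Balaban1989LargeFieldII, Thm 1 + (0.1) pp.355–356; Balaban1988Convergent, Thms 1–2 pp.262–263 (objects of record; bookkeeping)] -/
def IsDatumOfRecord₁₃CSepCoP (D : FiniteEpsData F (SU N)) : Prop :=
  ∃ (θ : Stage13Params F N) (h : θ.Provisos₁₃SepCoP F N), θ.Admissible F N ∧ D = datumOfRecord₁₃SepCoP F N θ h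

/-- Every admissible Stage-13 parameter tuple with provisos yields a datum of record. [cite: Balaban1989LargeFieldII, Thm 1 + (0.1) pp.355–356 (bookkeeping)] -/
theorem isDatumOfRecord₁₃CSepCoP_datumOfRecord₁₃SepCoP (θ : Stage13Params F N) (h : θ.Provisos₁₃SepCoP F N) (hθ : θ.Admissible F N) :
    IsDatumOfRecord₁₃CSepCoP F N (datumOfRecord₁₃SepCoP F N θ h) :=
  ⟨θ, h, hθ, rfl⟩

/-- **K0′ READS THE SAME AT THE DATUM**: some datum of record exists at `(F, N)` iff some Stage-13 record pair `(D, w)` exists (the body of the route's K0′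
`Record12Inhabited` at `N`). [cite: Balaban1989LargeFieldII, Thm 1 + (0.1) pp.355–356 (bookkeeping)] -/
theorem exists_isDatumOfRecord₁₃CSepCoP_iff_exists_record :
    (∃ D : FiniteEpsData F (SU N), IsDatumOfRecord₁₃CSepCoP F N D) ↔ ∃ (D : FiniteEpsData F (SU N)) (w : WorldP), IsRecordOfRecord₁₃CSepCoP F N D w := by
  constructor
  · rintro ⟨_, θ, hP, hθ, rfl⟩
    obtain ⟨w, hw, -⟩ := exists_world_isRecordOfRecord₁₃CSepCoP F N θ hP hθ ⟨hθ.toStage9.gamma_pos, le_rfl⟩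
    exact ⟨_, w, hw⟩
  · rintro ⟨D, w, hw⟩
    exact ⟨D, exists_provisos_of_isRecordOfRecord₁₃CSepCoP hw⟩

/-- **THE HONEST REDUCTION OF K0′**: some datum of record exists at `(F, N)` iff SOME Stage-13 parameter tuple is admissible and satisfies every displayed proviso —
«exhibit ONE admissible `Stage13Params` with EVERY proviso field a theorem» (the K0′ components); inhabitation is NOT claimed in this module.
[cite: Balaban1988Convergent, (2.7) p.255, (2.21) p.258, (2.28) p.259, (3.16) p.268, (3.21) p.269; Balaban1987RG1, (1.12)–(1.15) p.262 (hypothesis dictionary; bookkeeping)] -/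
theorem exists_isDatumOfRecord₁₃CSepCoP_iff_exists_params :
    (∃ D : FiniteEpsData F (SU N), IsDatumOfRecord₁₃CSepCoP F N D) ↔ ∃ θ : Stage13Params F N, θ.Provisos₁₃SepCoP F N ∧ θ.Admissible F N := by
  constructor
  · rintro ⟨_, θ, hP, hθ, -⟩
    exact ⟨θ, hP, hθ⟩
  · rintro ⟨θ, hP, hθ⟩
    exact ⟨_, isDatumOfRecord₁₃CSepCoP_datumOfRecord₁₃SepCoP F N θ hP hθ⟩

variable {F N}
variable {D : FiniteEpsData F (SU N)} {w : WorldP}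

/-- A Stage-13 record's datum is a Stage-13 datum of record. [cite: Balaban1989LargeFieldII, Thm 1 p.355 (bookkeeping)] -/
theorem isDatumOfRecord₁₃CSepCoP_of_isRecordOfRecord₁₃CSepCoP (h : IsRecordOfRecord₁₃CSepCoP F N D w) : IsDatumOfRecord₁₃CSepCoP F N D :=
  exists_provisos_of_isRecordOfRecord₁₃CSepCoP h

/-- **DATUM OF RECORD ⟺ RECORD AT SOME WORLD.** [cite: Balaban1989LargeFieldII, Thm 1 + (0.1) pp.355–356 (bookkeeping)] -/
theorem isDatumOfRecord₁₃CSepCoP_iff_exists_world : IsDatumOfRecord₁₃CSepCoP F N D ↔ ∃ w : WorldP, IsRecordOfRecord₁₃CSepCoP F N D w := by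
  constructor
  · rintro ⟨θ, hP, hθ, rfl⟩
    obtain ⟨w, hw, -⟩ := exists_world_isRecordOfRecord₁₃CSepCoP F N θ hP hθ ⟨hθ.toStage9.gamma_pos, le_rfl⟩
    exact ⟨w, hw⟩
  · rintro ⟨w, hw⟩
    exact isDatumOfRecord₁₃CSepCoP_of_isRecordOfRecord₁₃CSepCoP hw

/-- **THE CANONICAL STAGE-13 PARAMETER OF A DATUM OF RECORD** (choice) — the ONE key both carrier records of clusters K4 ∕ K5 are read at.
[cite: Balaban1989LargeFieldII, Thm 1 + (0.1) pp.355–356 (bookkeeping)] -/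
def IsDatumOfRecord₁₃CSepCoP.params (h : IsDatumOfRecord₁₃CSepCoP F N D) : Stage13Params F N :=
  Classical.choose h

/-- Its provisos. [cite: Balaban1988Convergent, (2.7) p.255, (2.21) p.258, (2.35) p.261 (bookkeeping)] -/
theorem IsDatumOfRecord₁₃CSepCoP.provisos (h : IsDatumOfRecord₁₃CSepCoP F N D) : h.params.Provisos₁₃SepCoP F N :=
  (Classical.choose_spec h).fst

/-- Its admissibility. [cite: Balaban1987RG1, (1.12) p.262; Balaban1988Convergent, (2.10) p.256 (bookkeeping)] -/
theorem IsDatumOfRecord₁₃CSepCoP.admissible (h : IsDatumOfRecord₁₃CSepCoP F N D) : h.params.Admissible F N :=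
  (Classical.choose_spec h).snd.1

/-- **The datum IS the datum of record of its canonical parameter.** [cite: Balaban1989LargeFieldII, Thm 1 p.355 (bookkeeping)] -/
theorem IsDatumOfRecord₁₃CSepCoP.eq_datumOfRecord₁₃SepCoP (h : IsDatumOfRecord₁₃CSepCoP F N D) : D = datumOfRecord₁₃SepCoP F N h.params h.provisos :=
  (Classical.choose_spec h).snd.2

/-- The canonical parameter's coupling window is positive. [cite: Balaban1987RG1, (0.21) p.256 (bookkeeping)] -/
theorem IsDatumOfRecord₁₃CSepCoP.gamma_pos (h : IsDatumOfRecord₁₃CSepCoP F N D) : 0 < h.params.γ :=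
  h.admissible.toStage9.gamma_pos

/-- … and lies inside `]0, 1[` (the Stage-12 sign `γ < 1` of the tuple's Stage-12 admissibility). [cite: Balaban1988Convergent, (2.28) p.259 (bookkeeping)] -/
theorem IsDatumOfRecord₁₃CSepCoP.gamma_lt_one (h : IsDatumOfRecord₁₃CSepCoP F N D) : h.params.γ < 1 :=
  h.admissible.toStage12.pos₁₂.2.2.2.2

/-- **WHAT A CONSUMER PROVES ⟹ WHAT THE INSTANCE CARRIES**: a property of the objects of record established at EVERY admissible Stage-13 parameter tuple with provisos
holds at the canonical parameter of every datum of record. [cite: Balaban1989LargeFieldII, Thm 1 p.355 (bookkeeping)] -/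
theorem IsDatumOfRecord₁₃CSepCoP.forall_params {P : (D : FiniteEpsData F (SU N)) → (θ : Stage13Params F N) → θ.Provisos₁₃SepCoP F N → Prop}
    (hP : ∀ (θ : Stage13Params F N) (hθ : θ.Provisos₁₃SepCoP F N), θ.Admissible F N → P (datumOfRecord₁₃SepCoP F N θ hθ) θ hθ) (h : IsDatumOfRecord₁₃CSepCoP F N D) :
    P D h.params h.provisos := by
  have := hP h.params h.provisos h.admissible
  rwa [← h.eq_datumOfRecord₁₃SepCoP] at this

/-- **WORLD COMPANION IN `₁₃C` AT ANY WINDOW BELOW THE CANONICAL ONE**: for `0 < γw ≤ h.params.γ` some world makes `(D, w)` a Stage-13 record with `w.γ = γw` — what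
the N17 home-keying binder («`RRec … R → ∃ w, IsRecordOfRecord₁₃CSepCoP F N D w ∧ R.u3.γ = w.γ`») consumes once `R.u3.γ` is pinned in that range.
[cite: Balaban1989LargeFieldII, Thm 1 + (0.1) pp.355–356 (bookkeeping)] -/
theorem IsDatumOfRecord₁₃CSepCoP.exists_world (h : IsDatumOfRecord₁₃CSepCoP F N D) {γw : ℝ} (hγw : 0 < γw ∧ γw ≤ h.params.γ) :
    ∃ w : WorldP, IsRecordOfRecord₁₃CSepCoP F N D w ∧ w.γ = γw := by
  obtain ⟨w, hw, hγ⟩ := exists_world_isRecordOfRecord₁₃CSepCoP F N h.params h.provisos h.admissible hγw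
  exact ⟨w, h.eq_datumOfRecord₁₃SepCoP ▸ hw, hγ⟩

/-- … in particular at the canonical window `h.params.γ` itself. [cite: Balaban1989LargeFieldII, Thm 1 + (0.1) pp.355–356 (bookkeeping)] -/
theorem IsDatumOfRecord₁₃CSepCoP.exists_world_gamma (h : IsDatumOfRecord₁₃CSepCoP F N D) :
    ∃ w : WorldP, IsRecordOfRecord₁₃CSepCoP F N D w ∧ w.γ = h.params.γ :=
  h.exists_world ⟨h.gamma_pos, le_rfl⟩

/-- **THE DATUM's β-FUNCTIONS ARE THE STAGE-13 β OF RECORD AT THE CANONICAL PARAMETER** (def-T's `βfun_datumOfRecord₁₃SepCoP`, `rfl` there; `betaOfRecord₁₃ F N θ` over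
`Stage13Params` is def-T's reducible name for the β of record re-based on the canonical-version transport and the (2.9)-species small-field function — NOT `betaOfRecord₁₀` of Stages 10–12: the histories of record differ, and there is
NO ₁₂ ↔ ₁₃ key bridge in this module) — what the (D4) read-out binders and node N17 read off `D`.
[cite: Balaban1987RG1, (1.20)–(1.22) p.264 (bookkeeping)] -/
theorem IsDatumOfRecord₁₃CSepCoP.βfun_eq_betaOfRecord₁₃ (h : IsDatumOfRecord₁₃CSepCoP F N D) : D.βfun = betaOfRecord₁₃ F N h.params := by
  have := βfun_datumOfRecord₁₃SepCoP F N h.params h.provisos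
  rwa [← h.eq_datumOfRecord₁₃SepCoP] at this

/-- The datum's coupling flow of the run `p` IS the Stage-13 generated history of record of the canonical parameter (def-T's `flow_g_datumOfRecord₁₃SepCoP`).
[cite: Balaban1987RG1, (0.17)–(0.20) pp.255–256 (bookkeeping)] -/
theorem IsDatumOfRecord₁₃CSepCoP.flow_g (h : IsDatumOfRecord₁₃CSepCoP F N D) (p : B12.RunParams) :
    (D.C p).flow.g = gOfRecord₁₃ F N h.params p := by
  have := flow_g_datumOfRecord₁₃SepCoP F N h.params h.provisos p
  rwa [← h.eq_datumOfRecord₁₃SepCoP] at this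

/-- The datum's averaging maps ARE the averaging maps of record. [cite: Balaban1987RG1, (0.4) p.253 (bookkeeping)] -/
theorem IsDatumOfRecord₁₃CSepCoP.av_eq (h : IsDatumOfRecord₁₃CSepCoP F N D) : D.av = avOfRecord F N := by
  have := av_datumOfRecord₁₃SepCoP F N h.params h.provisos
  rwa [← h.eq_datumOfRecord₁₃SepCoP] at this

/-- A Stage-13 datum of record is a datum of record, Stage 0 (binder B1 ∕ node N23's reading). [cite: Balaban1987RG1, (0.3)–(0.4) p.253 (bookkeeping)] -/
theorem IsDatumOfRecord₁₃CSepCoP.isDatumOfRecord₀ (h : IsDatumOfRecord₁₃CSepCoP F N D) : IsDatumOfRecord₀ F N D := by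
  rw [h.eq_datumOfRecord₁₃SepCoP]
  exact isDatumOfRecord₀_datumOfRecord₁₃SepCoP F N h.params h.provisos

/-- N23 · binder B1 at every Stage-13 datum of record. [cite: Balaban1987RG1, (0.4) p.253] -/
theorem IsDatumOfRecord₁₃CSepCoP.isPrintedAveraged (h : IsDatumOfRecord₁₃CSepCoP F N D) : D.IsPrintedAveraged := by
  rw [h.eq_datumOfRecord₁₃SepCoP]
  exact isPrintedAveraged_datumOfRecord₁₃SepCoP F N h.params h.provisos

/-- **THE ₅C SHADOW AT THE CANONICAL PARAMETER**: a Stage-13 datum of record is refined by a Stage-5 C-bound record at some world (def-T's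
`exists_isRecordOfRecord₅C_of_isRecordOfRecord₁₃CSepCoP` through the world companion) — for consumers keyed at ₅C. [cite: Balaban1989LargeFieldII, Thm 1 + (0.1) pp.355–356 (bookkeeping)] -/
theorem IsDatumOfRecord₁₃CSepCoP.exists_isRecordOfRecord₅C (h : IsDatumOfRecord₁₃CSepCoP F N D) :
    ∃ (D₅ : FiniteEpsData F (SU N)) (w : WorldP), IsRecordOfRecord₅C F N D₅ w ∧ D₅.C = D.C ∧ (∀ K g₀ k, D₅.dens K g₀ k = D.dens K g₀ k) ∧
      D₅.βfun = D.βfun ∧ D₅.av = D.av := by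
  obtain ⟨w, hw, -⟩ := h.exists_world_gamma
  obtain ⟨D₅, h₅⟩ := exists_isRecordOfRecord₅C_of_isRecordOfRecord₁₃CSepCoP hw
  exact ⟨D₅, w, h₅⟩

end DatumKey

/-! ## §2. Canonicalised readings — COHERENCE for records keyed «`∃ θ hP, θ.Admissible F N ∧ D = datumOfRecord₁₃SepCoP F N θ hP ∧ S = cr F θ hP …`»

Reading an existentially keyed record through `canon₁₃SepCoP f` makes the admitted bundle a function of the DATUM: `canon₁₃SepCoP f θ hP = f h.params h.provisos` whenever
`datumOfRecord₁₃SepCoP F N θ hP = D` and `h : IsDatumOfRecord₁₃CSepCoP F N D` (`canon₁₃SepCoP_eq_of_eq`), so two records keyed independently but read through `canon₁₃SepCoP` admit, at the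
same `(F, D, g₀, os)`, bundles read at the SAME parameter (`exists_keyed_canon₁₃SepCoP_iff` turns either key into «`∃ h : IsDatumOfRecord₁₃CSepCoP F N D, Φ (f h.params
h.provisos)`»).  Off the datum-of-record class `canon₁₃SepCoP f = f`. -/
section Canon

variable (F : T4Family) (N : ℕ) [NeZero N] {α : Sort*}

/-- **CANONICALISED READING**: read `f` at the canonical parameter of the datum `datumOfRecord₁₃SepCoP F N θ hP` when that datum is of record (admissible), else at
`(θ, hP)` itself.  Kernel bookkeeping (`Classical.dec`, `dite`). [cite: Balaban1989LargeFieldII, Thm 1 + (0.1) pp.355–356 (bookkeeping)] -/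
def canon₁₃SepCoP (f : (θ : Stage13Params F N) → θ.Provisos₁₃SepCoP F N → α) (θ : Stage13Params F N) (hP : θ.Provisos₁₃SepCoP F N) : α := by
  classical
  exact if h : IsDatumOfRecord₁₃CSepCoP F N (datumOfRecord₁₃SepCoP F N θ hP) then f h.params h.provisos else f θ hP

variable {F N}

/-- The canonical parameter depends on the datum only: transport of the key along `D = D'` does not change `.params` (proof irrelevance + `subst`).
[cite: Balaban1989LargeFieldII, Thm 1 + (0.1) pp.355–356 (bookkeeping)] -/
theorem IsDatumOfRecord₁₃CSepCoP.params_congr {D D' : FiniteEpsData F (SU N)} (h : IsDatumOfRecord₁₃CSepCoP F N D) (h' : IsDatumOfRecord₁₃CSepCoP F N D') (e : D = D') :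
    h.params = h'.params := by
  subst e
  rfl

/-- **`canon₁₃SepCoP f θ hP = f h.params h.provisos`** whenever `(θ, hP)` realises a datum of record `D` with key `h`. [cite: Balaban1989LargeFieldII, Thm 1 + (0.1) pp.355–356 (bookkeeping)] -/
theorem canon₁₃SepCoP_eq_of_eq {f : (θ : Stage13Params F N) → θ.Provisos₁₃SepCoP F N → α} {D : FiniteEpsData F (SU N)} (h : IsDatumOfRecord₁₃CSepCoP F N D)
    (θ : Stage13Params F N) (hP : θ.Provisos₁₃SepCoP F N) (e : D = datumOfRecord₁₃SepCoP F N θ hP) :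
    canon₁₃SepCoP F N f θ hP = f h.params h.provisos := by
  subst e
  unfold canon₁₃SepCoP
  rw [dif_pos h]

/-- At the canonical parameter itself `canon₁₃SepCoP f` reads `f`. [cite: Balaban1989LargeFieldII, Thm 1 + (0.1) pp.355–356 (bookkeeping)] -/
theorem canon₁₃SepCoP_params {f : (θ : Stage13Params F N) → θ.Provisos₁₃SepCoP F N → α} {D : FiniteEpsData F (SU N)} (h : IsDatumOfRecord₁₃CSepCoP F N D) :
    canon₁₃SepCoP F N f h.params h.provisos = f h.params h.provisos :=
  canon₁₃SepCoP_eq_of_eq h h.params h.provisos h.eq_datumOfRecord₁₃SepCoP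

/-- At an admissible tuple with provisos, `canon₁₃SepCoP f` reads `f` at the canonical parameter of ITS datum. [cite: Balaban1989LargeFieldII, Thm 1 + (0.1) pp.355–356 (bookkeeping)] -/
theorem canon₁₃SepCoP_eq_of_admissible {f : (θ : Stage13Params F N) → θ.Provisos₁₃SepCoP F N → α} (θ : Stage13Params F N) (hP : θ.Provisos₁₃SepCoP F N) (hθ : θ.Admissible F N) :
    canon₁₃SepCoP F N f θ hP = f (isDatumOfRecord₁₃CSepCoP_datumOfRecord₁₃SepCoP F N θ hP hθ).params (isDatumOfRecord₁₃CSepCoP_datumOfRecord₁₃SepCoP F N θ hP hθ).provisos :=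
  canon₁₃SepCoP_eq_of_eq _ θ hP rfl

/-- Off the datum-of-record class nothing is canonicalised. [cite: Balaban1989LargeFieldII, Thm 1 + (0.1) pp.355–356 (bookkeeping)] -/
theorem canon₁₃SepCoP_eq_self_of_not {f : (θ : Stage13Params F N) → θ.Provisos₁₃SepCoP F N → α} (θ : Stage13Params F N) (hP : θ.Provisos₁₃SepCoP F N)
    (hn : ¬ IsDatumOfRecord₁₃CSepCoP F N (datumOfRecord₁₃SepCoP F N θ hP)) : canon₁₃SepCoP F N f θ hP = f θ hP := by
  unfold canon₁₃SepCoP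
  rw [dif_neg hn]

/-- **THE KEYED-RECORD FACE**: an existentially keyed record («some admissible `θ` with provisos realises `D` and the bundle reads `canon₁₃SepCoP f` there») IS the
datum-keyed record («the bundle reads `f` at the canonical parameter of `D`») — for every property `Φ` of the reading (e.g. `Φ x := S = x g₀ os`).  This is the
sentence that makes (T-SPINE)'s and (T-RATE)'s Stage-13 records COHERENT. [cite: Balaban1989LargeFieldII, Thm 1 + (0.1) pp.355–356 (bookkeeping)] -/
theorem exists_keyed_canon₁₃SepCoP_iff {f : (θ : Stage13Params F N) → θ.Provisos₁₃SepCoP F N → α} {D : FiniteEpsData F (SU N)} (Φ : α → Prop) :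
    (∃ (θ : Stage13Params F N) (hP : θ.Provisos₁₃SepCoP F N), θ.Admissible F N ∧ D = datumOfRecord₁₃SepCoP F N θ hP ∧ Φ (canon₁₃SepCoP F N f θ hP)) ↔
      ∃ h : IsDatumOfRecord₁₃CSepCoP F N D, Φ (f h.params h.provisos) := by
  constructor
  · rintro ⟨θ, hP, hθ, e, hΦ⟩
    have h : IsDatumOfRecord₁₃CSepCoP F N D := ⟨θ, hP, hθ, e⟩
    refine ⟨h, ?_⟩
    rwa [canon₁₃SepCoP_eq_of_eq (f := f) h θ hP e] at hΦ
  · rintro ⟨h, hΦ⟩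
    refine ⟨h.params, h.provisos, h.admissible, h.eq_datumOfRecord₁₃SepCoP, ?_⟩
    rwa [canon₁₃SepCoP_params (f := f) h]

/-- **COHERENCE**: two existentially keyed records read through `canon₁₃SepCoP` admit, at the same datum, readings AT THE SAME PARAMETER.
[cite: Balaban1989LargeFieldII, Thm 1 + (0.1) pp.355–356 (bookkeeping)] -/
theorem keyed_canon₁₃SepCoP_coherent {β : Sort*} {f : (θ : Stage13Params F N) → θ.Provisos₁₃SepCoP F N → α} {g : (θ : Stage13Params F N) → θ.Provisos₁₃SepCoP F N → β}
    {D : FiniteEpsData F (SU N)} (Φ : α → Prop) (Ψ : β → Prop)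
    (hΦ : ∃ (θ : Stage13Params F N) (hP : θ.Provisos₁₃SepCoP F N), θ.Admissible F N ∧ D = datumOfRecord₁₃SepCoP F N θ hP ∧ Φ (canon₁₃SepCoP F N f θ hP))
    (hΨ : ∃ (θ : Stage13Params F N) (hP : θ.Provisos₁₃SepCoP F N), θ.Admissible F N ∧ D = datumOfRecord₁₃SepCoP F N θ hP ∧ Ψ (canon₁₃SepCoP F N g θ hP)) :
    ∃ h : IsDatumOfRecord₁₃CSepCoP F N D, Φ (f h.params h.provisos) ∧ Ψ (g h.params h.provisos) := by
  obtain ⟨h, h₁⟩ := (exists_keyed_canon₁₃SepCoP_iff Φ).1 hΦ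
  obtain ⟨h', h₂⟩ := (exists_keyed_canon₁₃SepCoP_iff Ψ).1 hΨ
  exact ⟨h, h₁, h₂⟩

end Canon

/-! ## §3. The θ-exposed Stage-13 record key `IsRateKey₁₃SepCoP` and the residual ASSIGNMENTS of the rate-record home at Stage 13 (`RateAssignment₁₃` ∕ `SpineAssignment₁₃` over
`Stage13Params`, with the one-token lifts `.ofStage12` ∕ `.ofStage9` of the Stage-12 ∕ Stage-9-typed assignments; RR-1's object containers BY NAME) -/

section Key

variable (F : T4Family) (N : ℕ) [NeZero N]

/-- **«(D, w) is the Stage-13 record WITH PARAMETERS θ»**: the body of `IsRecordOfRecord₁₃CSepCoP F N D w` with the Stage-13 parameter tuple EXPOSED — θ is admissible and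
satisfies its displayed provisos, its datum of record IS `D`, and the world `w` is bound to the construction with a window `0 < w.γ ≤ θ.γ`, Bałaban's block size and
the C-binding of record over the Stage-13 view. [cite: Balaban1989LargeFieldII, Thm 1 + (0.1) pp.355–356; Balaban1987RG1, (0.24)–(0.25) p.257 (objects of record; bookkeeping)] -/
def IsRateKey₁₃SepCoP (D : FiniteEpsData F (SU N)) (w : WorldP) (θ : Stage13Params F N) : Prop :=
  ∃ h : θ.Provisos₁₃SepCoP F N, θ.Admissible F N ∧ D = datumOfRecord₁₃SepCoP F N θ h ∧ w.C = D.C ∧ (0 < w.γ ∧ w.γ ≤ θ.γ) ∧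
    w.L = (θ.L : ℝ) ∧ ∀ P : B12.RunParams, w.up P = upOfRecord₅C F N (θ.toStage5₁₃CoP F N) P

/-- **A Stage-13 record IS a keyed record for SOME θ, and conversely** (`Iff.rfl`: the key is `IsRecordOfRecord₁₃CSepCoP`'s body). [cite: Balaban1989LargeFieldII, Thm 1 + (0.1) pp.355–356 (bookkeeping)] -/
theorem isRecordOfRecord₁₃CSepCoP_iff_exists_isRateKey₁₃SepCoP (D : FiniteEpsData F (SU N)) (w : WorldP) :
    IsRecordOfRecord₁₃CSepCoP F N D w ↔ ∃ θ : Stage13Params F N, IsRateKey₁₃SepCoP F N D w θ := Iff.rfl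

/-- **Pointed form of the key** at the datum of record. [cite: Balaban1989LargeFieldII, Thm 1 + (0.1) pp.355–356 (bookkeeping)] -/
theorem isRateKey₁₃SepCoP_of_eq (θ : Stage13Params F N) (h : θ.Provisos₁₃SepCoP F N) (hθ : θ.Admissible F N) (w : WorldP)
    (hC : w.C = (datumOfRecord₁₃SepCoP F N θ h).C) (hγ : 0 < w.γ ∧ w.γ ≤ θ.γ) (hL : w.L = (θ.L : ℝ))
    (hup : ∀ P, w.up P = upOfRecord₅C F N (θ.toStage5₁₃CoP F N) P) :
    IsRateKey₁₃SepCoP F N (datumOfRecord₁₃SepCoP F N θ h) w θ :=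
  ⟨h, hθ, rfl, hC, hγ, hL, hup⟩

/-- **Every admissible θ satisfying its provisos is keyed at some world with any window `0 < γw ≤ θ.γ`** — inhabitation of the keyed class is Stage 13's exactly.
[cite: Balaban1989LargeFieldII, Thm 1 + (0.1) pp.355–356 (bookkeeping)] -/
theorem exists_world_isRateKey₁₃SepCoP (θ : Stage13Params F N) (h : θ.Provisos₁₃SepCoP F N) (hθ : θ.Admissible F N) {γw : ℝ} (hγw : 0 < γw ∧ γw ≤ θ.γ) :
    ∃ w : WorldP, IsRateKey₁₃SepCoP F N (datumOfRecord₁₃SepCoP F N θ h) w θ ∧ w.γ = γw := by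
  obtain ⟨w₀⟩ := nonempty_worldP
  exact ⟨{ w₀ with
      C := (datumOfRecord₁₃SepCoP F N θ h).C, γ := γw, L := (θ.L : ℝ), one_lt_L := by exact_mod_cast θ.hL.2,
      up := fun P => upOfRecord₅C F N (θ.toStage5₁₃CoP F N) P },
    ⟨h, hθ, rfl, rfl, hγw, rfl, fun _ => rfl⟩, rfl⟩

variable {F N}
variable {D : FiniteEpsData F (SU N)} {w : WorldP} {θ : Stage13Params F N}

/-- A keyed record is a Stage-13 record. [cite: Balaban1989LargeFieldII, Thm 1 + (0.1) pp.355–356 (bookkeeping)] -/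
theorem IsRateKey₁₃SepCoP.isRecordOfRecord₁₃CSepCoP (hk : IsRateKey₁₃SepCoP F N D w θ) : IsRecordOfRecord₁₃CSepCoP F N D w := ⟨θ, hk⟩

/-- … hence its datum is a Stage-13 datum of record. [cite: Balaban1989LargeFieldII, Thm 1 p.355 (bookkeeping)] -/
theorem IsRateKey₁₃SepCoP.isDatumOfRecord₁₃CSepCoP (hk : IsRateKey₁₃SepCoP F N D w θ) : IsDatumOfRecord₁₃CSepCoP F N D :=
  isDatumOfRecord₁₃CSepCoP_of_isRecordOfRecord₁₃CSepCoP hk.isRecordOfRecord₁₃CSepCoP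

/-- The key CERTIFIES θ's provisos and admissibility and realises `D` as θ's datum of record. [cite: Balaban1989LargeFieldI, (0.3)–(0.4) p.176 (bookkeeping)] -/
theorem IsRateKey₁₃SepCoP.exists_provisos (hk : IsRateKey₁₃SepCoP F N D w θ) : ∃ h : θ.Provisos₁₃SepCoP F N, θ.Admissible F N ∧ D = datumOfRecord₁₃SepCoP F N θ h := by
  obtain ⟨h, hθ, hD, -⟩ := hk
  exact ⟨h, hθ, hD⟩

/-- The key's θ is admissible. [cite: Balaban1987RG1, (1.20)–(1.21) p.264 (hypothesis dictionary; bookkeeping)] -/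
theorem IsRateKey₁₃SepCoP.admissible (hk : IsRateKey₁₃SepCoP F N D w θ) : θ.Admissible F N := by
  obtain ⟨-, hθ, -⟩ := hk
  exact hθ

/-- The world's window is positive. [cite: Balaban1987RG1, Thm 1 p.259 (bookkeeping)] -/
theorem IsRateKey₁₃SepCoP.gamma_pos (hk : IsRateKey₁₃SepCoP F N D w θ) : 0 < w.γ := by
  obtain ⟨-, -, -, -, hγ, -⟩ := hk
  exact hγ.1

/-- The world's window sits inside θ's coupling window: `w.γ ≤ θ.γ`. [cite: Balaban1987RG1, Thm 1 p.259 (bookkeeping)] -/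
theorem IsRateKey₁₃SepCoP.gamma_le (hk : IsRateKey₁₃SepCoP F N D w θ) : w.γ ≤ θ.γ := by
  obtain ⟨-, -, -, -, hγ, -⟩ := hk
  exact hγ.2

/-- The world reads θ's block factor. [cite: Balaban1987RG1, (0.1) p.251 (bookkeeping)] -/
theorem IsRateKey₁₃SepCoP.L_eq (hk : IsRateKey₁₃SepCoP F N D w θ) : w.L = (θ.L : ℝ) := by
  obtain ⟨-, -, -, -, -, hL, -⟩ := hk
  exact hL

/-- The world is bound to the datum's construction. [cite: Balaban1989LargeFieldII, Thm 1 + (0.1) pp.355–356 (bookkeeping)] -/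
theorem IsRateKey₁₃SepCoP.construction_eq (hk : IsRateKey₁₃SepCoP F N D w θ) : w.C = D.C := by
  obtain ⟨-, -, -, hC, -⟩ := hk
  exact hC

/-- The upstream block of the world is the C-binding of record at the Stage-13 view. [cite: Balaban1989LargeFieldII, Thm 1 + (0.1) pp.355–356 (bookkeeping)] -/
theorem IsRateKey₁₃SepCoP.up_eq (hk : IsRateKey₁₃SepCoP F N D w θ) (P : B12.RunParams) : w.up P = upOfRecord₅C F N (θ.toStage5₁₃CoP F N) P := by
  obtain ⟨-, -, -, -, -, -, hup⟩ := hk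
  exact hup P

end Key


/-! ## §4. «`D` is a datum of record, Stage 13, realised IN THE REGIME `Rg`» and its canonical parameter in the regime -/

section DatumKeyOn

variable (F : T4Family) (N : ℕ) [NeZero N]

/-- **«`D` is a datum of record, Stage 13, realised in the regime `Rg`»**: SOME admissible Stage-13 parameter tuple IN `Rg` satisfying its displayed provisos has `D` as its datum
of record — the common key prefix of the regime-restricted carrier homes (the Stage-13 re-keys of `YMDAG.UVSplit.RRec₁₂On 𝔯 Rg` ∕ `SRec₁₂On cr Rg`).  At `Rg := ⊤` it is the C key (`isDatumOfRecord₁₃CSepCoPOn_true_iff`).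
[cite: Balaban1989LargeFieldII, Thm 1 + (0.1) pp.355–356; Balaban1988Convergent, Thms 1–2 pp.262–263 (objects of record; bookkeeping)] -/
def IsDatumOfRecord₁₃CSepCoPOn (Rg : (F : T4Family) → Stage13Params F N → Prop) (D : FiniteEpsData F (SU N)) : Prop :=
  ∃ (θ : Stage13Params F N) (h : θ.Provisos₁₃SepCoP F N), Rg F θ ∧ θ.Admissible F N ∧ D = datumOfRecord₁₃SepCoP F N θ h

variable (Rg : (F : T4Family) → Stage13Params F N → Prop)

/-- Unfolding (`Iff.rfl`). [cite: Balaban1989LargeFieldII, Thm 1 + (0.1) pp.355–356 (bookkeeping)] -/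
theorem isDatumOfRecord₁₃CSepCoPOn_iff (D : FiniteEpsData F (SU N)) :
    IsDatumOfRecord₁₃CSepCoPOn F N Rg D ↔ ∃ (θ : Stage13Params F N) (h : θ.Provisos₁₃SepCoP F N), Rg F θ ∧ θ.Admissible F N ∧ D = datumOfRecord₁₃SepCoP F N θ h :=
  Iff.rfl

/-- Every admissible Stage-13 parameter tuple in the regime with provisos yields a datum of record in the regime. [cite: Balaban1989LargeFieldII, Thm 1 + (0.1) pp.355–356 (bookkeeping)] -/
theorem isDatumOfRecord₁₃CSepCoPOn_datumOfRecord₁₃SepCoP (θ : Stage13Params F N) (h : θ.Provisos₁₃SepCoP F N) (hRg : Rg F θ) (hθ : θ.Admissible F N) :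
    IsDatumOfRecord₁₃CSepCoPOn F N Rg (datumOfRecord₁₃SepCoP F N θ h) :=
  ⟨θ, h, hRg, hθ, rfl⟩

/-- **THE HONEST REDUCTION, IN THE REGIME**: some datum of record in `Rg` exists at `(F, N)` iff SOME Stage-13 parameter tuple satisfies every displayed proviso, lies in `Rg` and
is admissible; inhabitation is NOT claimed in this module. [cite: Balaban1988Convergent, (2.7) p.255, (2.21) p.258, (3.16)–(3.22) pp.268–269; Balaban1987RG1, (1.12)–(1.15) p.262 (hypothesis dictionary; bookkeeping)] -/
theorem exists_isDatumOfRecord₁₃CSepCoPOn_iff_exists_params :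
    (∃ D : FiniteEpsData F (SU N), IsDatumOfRecord₁₃CSepCoPOn F N Rg D) ↔ ∃ θ : Stage13Params F N, θ.Provisos₁₃SepCoP F N ∧ Rg F θ ∧ θ.Admissible F N := by
  constructor
  · rintro ⟨_, θ, hP, hRg, hθ, -⟩
    exact ⟨θ, hP, hRg, hθ⟩
  · rintro ⟨θ, hP, hRg, hθ⟩
    exact ⟨_, isDatumOfRecord₁₃CSepCoPOn_datumOfRecord₁₃SepCoP F N Rg θ hP hRg hθ⟩

/-- **A PROPERTY OF EVERY DATUM OF RECORD IN THE REGIME ⟺ THE θ-KEYED SENTENCE GUARDED BY `Rg`** (datum level). [cite: Balaban1989LargeFieldII, Thm 1 + (0.1) pp.355–356 (bookkeeping)] -/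
theorem forall_isDatumOfRecord₁₃CSepCoPOn_iff (P : FiniteEpsData F (SU N) → Prop) :
    (∀ D : FiniteEpsData F (SU N), IsDatumOfRecord₁₃CSepCoPOn F N Rg D → P D) ↔
      ∀ (θ : Stage13Params F N) (h : θ.Provisos₁₃SepCoP F N), Rg F θ → θ.Admissible F N → P (datumOfRecord₁₃SepCoP F N θ h) := by
  constructor
  · intro hall θ h hRg hθ
    exact hall _ (isDatumOfRecord₁₃CSepCoPOn_datumOfRecord₁₃SepCoP F N Rg θ h hRg hθ)
  · rintro hall D ⟨θ, h, hRg, hθ, rfl⟩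
    exact hall θ h hRg hθ

variable {F N Rg}
variable {D : FiniteEpsData F (SU N)}

/-- The regime forgotten: a datum of record in `Rg` is a datum of record (C key). [cite: Balaban1989LargeFieldII, Thm 1 p.355 (bookkeeping)] -/
theorem IsDatumOfRecord₁₃CSepCoPOn.toC (h : IsDatumOfRecord₁₃CSepCoPOn F N Rg D) : IsDatumOfRecord₁₃CSepCoP F N D := by
  obtain ⟨θ, hP, -, hθ, hD⟩ := h
  exact ⟨θ, hP, hθ, hD⟩

/-- Monotone in the regime. [cite: Balaban1989LargeFieldII, Thm 1 p.355 (bookkeeping)] -/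
theorem IsDatumOfRecord₁₃CSepCoPOn.mono {Rg' : (F : T4Family) → Stage13Params F N → Prop} (hle : ∀ (F : T4Family) (θ : Stage13Params F N), Rg F θ → Rg' F θ)
    (h : IsDatumOfRecord₁₃CSepCoPOn F N Rg D) : IsDatumOfRecord₁₃CSepCoPOn F N Rg' D := by
  obtain ⟨θ, hP, hRg, hθ, hD⟩ := h
  exact ⟨θ, hP, hle F θ hRg, hθ, hD⟩

/-- At the trivial regime the key IS the C key. [cite: Balaban1989LargeFieldII, Thm 1 p.355 (bookkeeping)] -/
theorem isDatumOfRecord₁₃CSepCoPOn_true_iff : IsDatumOfRecord₁₃CSepCoPOn F N (fun _ _ => True) D ↔ IsDatumOfRecord₁₃CSepCoP F N D :=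
  ⟨fun h => h.toC, fun ⟨θ, hP, hθ, hD⟩ => ⟨θ, hP, trivial, hθ, hD⟩⟩

/-- A datum of record whose C-CANONICAL parameter lies in the regime is a datum of record in the regime (companion of the (T-RATE) home's `rRec₁₂On_of_regime_params`, re-keyed).
[cite: Balaban1989LargeFieldII, Thm 1 p.355 (bookkeeping)] -/
theorem IsDatumOfRecord₁₃CSepCoP.isDatumOfRecord₁₃CSepCoPOn_of_regime_params (h : IsDatumOfRecord₁₃CSepCoP F N D) (hRg : Rg F h.params) : IsDatumOfRecord₁₃CSepCoPOn F N Rg D :=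
  ⟨h.params, h.provisos, hRg, h.admissible, h.eq_datumOfRecord₁₃SepCoP⟩

/-- **THE CANONICAL STAGE-13 PARAMETER OF A DATUM OF RECORD IN THE REGIME** (choice).  HONEST: it need not equal the C-canonical parameter `h.toC.params` of the same datum
(two choices over two existentials); the regime reaches THIS parameter (`.regime`), never `IsDatumOfRecord₁₃CSepCoP.params`. [cite: Balaban1989LargeFieldII, Thm 1 + (0.1) pp.355–356 (bookkeeping)] -/
def IsDatumOfRecord₁₃CSepCoPOn.params (h : IsDatumOfRecord₁₃CSepCoPOn F N Rg D) : Stage13Params F N :=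
  Classical.choose h

/-- Its provisos. [cite: Balaban1988Convergent, (2.7) p.255, (2.21) p.258, (2.35) p.261 (bookkeeping)] -/
theorem IsDatumOfRecord₁₃CSepCoPOn.provisos (h : IsDatumOfRecord₁₃CSepCoPOn F N Rg D) : h.params.Provisos₁₃SepCoP F N :=
  (Classical.choose_spec h).fst

/-- **It lies IN THE REGIME.** [cite: Balaban1988Convergent, (3.16)–(3.22) pp.268–269 (bookkeeping)] -/
theorem IsDatumOfRecord₁₃CSepCoPOn.regime (h : IsDatumOfRecord₁₃CSepCoPOn F N Rg D) : Rg F h.params :=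
  (Classical.choose_spec h).snd.1

/-- Its admissibility. [cite: Balaban1987RG1, (1.12) p.262; Balaban1988Convergent, (2.10) p.256 (bookkeeping)] -/
theorem IsDatumOfRecord₁₃CSepCoPOn.admissible (h : IsDatumOfRecord₁₃CSepCoPOn F N Rg D) : h.params.Admissible F N :=
  (Classical.choose_spec h).snd.2.1

/-- **The datum IS the datum of record of its canonical parameter in the regime.** [cite: Balaban1989LargeFieldII, Thm 1 p.355 (bookkeeping)] -/
theorem IsDatumOfRecord₁₃CSepCoPOn.eq_datumOfRecord₁₃SepCoP (h : IsDatumOfRecord₁₃CSepCoPOn F N Rg D) : D = datumOfRecord₁₃SepCoP F N h.params h.provisos :=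
  (Classical.choose_spec h).snd.2.2

/-- The canonical parameter realises a C-datum key of `D` (pointed form; its `.params` is NOT asserted to be `h.params`). [cite: Balaban1989LargeFieldII, Thm 1 p.355 (bookkeeping)] -/
theorem IsDatumOfRecord₁₃CSepCoPOn.isDatumOfRecord₁₃CSepCoP_params (h : IsDatumOfRecord₁₃CSepCoPOn F N Rg D) :
    IsDatumOfRecord₁₃CSepCoP F N (datumOfRecord₁₃SepCoP F N h.params h.provisos) :=
  isDatumOfRecord₁₃CSepCoP_datumOfRecord₁₃SepCoP F N h.params h.provisos h.admissible

/-- The canonical parameter's coupling window is positive. [cite: Balaban1987RG1, (0.21) p.256 (bookkeeping)] -/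
theorem IsDatumOfRecord₁₃CSepCoPOn.gamma_pos (h : IsDatumOfRecord₁₃CSepCoPOn F N Rg D) : 0 < h.params.γ :=
  h.admissible.toStage9.gamma_pos

/-- … and lies inside `]0, 1[`. [cite: Balaban1988Convergent, (2.28) p.259 (bookkeeping)] -/
theorem IsDatumOfRecord₁₃CSepCoPOn.gamma_lt_one (h : IsDatumOfRecord₁₃CSepCoPOn F N Rg D) : h.params.γ < 1 :=
  h.admissible.toStage12.pos₁₂.2.2.2.2

/-- The canonical parameter in the regime depends on the datum only. [cite: Balaban1989LargeFieldII, Thm 1 + (0.1) pp.355–356 (bookkeeping)] -/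
theorem IsDatumOfRecord₁₃CSepCoPOn.params_congr {D' : FiniteEpsData F (SU N)} (h : IsDatumOfRecord₁₃CSepCoPOn F N Rg D) (h' : IsDatumOfRecord₁₃CSepCoPOn F N Rg D') (e : D = D') :
    h.params = h'.params := by
  subst e
  rfl

/-- **WHAT A CONSUMER PROVES IN THE REGIME ⟹ WHAT THE INSTANCE CARRIES**: a property of the objects of record established at EVERY admissible Stage-13 parameter tuple IN `Rg` with
provisos holds at the canonical parameter in the regime of every datum of record in the regime — the regime is AVAILABLE as a hypothesis. [cite: Balaban1989LargeFieldII, Thm 1 p.355 (bookkeeping)] -/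
theorem IsDatumOfRecord₁₃CSepCoPOn.forall_params {P : (D : FiniteEpsData F (SU N)) → (θ : Stage13Params F N) → θ.Provisos₁₃SepCoP F N → Prop}
    (hP : ∀ (θ : Stage13Params F N) (hθ : θ.Provisos₁₃SepCoP F N), Rg F θ → θ.Admissible F N → P (datumOfRecord₁₃SepCoP F N θ hθ) θ hθ) (h : IsDatumOfRecord₁₃CSepCoPOn F N Rg D) :
    P D h.params h.provisos := by
  have := hP h.params h.provisos h.regime h.admissible
  rwa [← h.eq_datumOfRecord₁₃SepCoP] at this

/-- The datum's β-functions are the Stage-13 β of record at the canonical parameter. [cite: Balaban1987RG1, (1.20)–(1.22) p.264 (bookkeeping)] -/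
theorem IsDatumOfRecord₁₃CSepCoPOn.βfun_eq_betaOfRecord₁₃ (h : IsDatumOfRecord₁₃CSepCoPOn F N Rg D) : D.βfun = betaOfRecord₁₃ F N h.params := by
  have := βfun_datumOfRecord₁₃SepCoP F N h.params h.provisos
  rwa [← h.eq_datumOfRecord₁₃SepCoP] at this

/-- The datum's coupling flow of the run `p` IS the Stage-13 generated history of record of the canonical parameter. [cite: Balaban1987RG1, (0.17)–(0.20) pp.255–256 (bookkeeping)] -/
theorem IsDatumOfRecord₁₃CSepCoPOn.flow_g (h : IsDatumOfRecord₁₃CSepCoPOn F N Rg D) (p : B12.RunParams) :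
    (D.C p).flow.g = gOfRecord₁₃ F N h.params p := by
  have := flow_g_datumOfRecord₁₃SepCoP F N h.params h.provisos p
  rwa [← h.eq_datumOfRecord₁₃SepCoP] at this

/-- A datum of record in the regime is a datum of record, Stage 0. [cite: Balaban1987RG1, (0.3)–(0.4) p.253 (bookkeeping)] -/
theorem IsDatumOfRecord₁₃CSepCoPOn.isDatumOfRecord₀ (h : IsDatumOfRecord₁₃CSepCoPOn F N Rg D) : IsDatumOfRecord₀ F N D :=
  h.toC.isDatumOfRecord₀


end DatumKeyOn

/-! ## §5. «`(D, w)` is a Stage-13 record realised IN THE REGIME `Rg`»; world companions; the θ-keyed guarded junction -/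

section RecordKeyOn

variable (F : T4Family) (N : ℕ) [NeZero N]

/-- **«`(D, w)` is a Stage-13 record (C-class) realised in the regime `Rg`»**: `IsRecordOfRecord₁₃CSepCoP F N D w`'s body (the θ-exposed key `IsRateKey₁₃SepCoP`) with the parameter IN
`Rg` — the regime-restricted record class a guarded composer quantifies over (`Spine`, `S_R00x`, `S_N27x` at `fun F D w => IsRecordOfRecord₁₃CSepCoPOn F N Rg D w`).  At `Rg := ⊤` it is
`IsRecordOfRecord₁₃CSepCoP` (`isRecordOfRecord₁₃CSepCoPOn_true_iff`). [cite: Balaban1989LargeFieldII, Thm 1 + (0.1) pp.355–356; Balaban1987RG1, (0.24)–(0.25) p.257 (objects of record; bookkeeping)] -/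
def IsRecordOfRecord₁₃CSepCoPOn (Rg : (F : T4Family) → Stage13Params F N → Prop) (D : FiniteEpsData F (SU N)) (w : WorldP) : Prop :=
  ∃ θ : Stage13Params F N, Rg F θ ∧ IsRateKey₁₃SepCoP F N D w θ

variable (Rg : (F : T4Family) → Stage13Params F N → Prop)

/-- Unfolding (`Iff.rfl`). [cite: Balaban1989LargeFieldII, Thm 1 + (0.1) pp.355–356 (bookkeeping)] -/
theorem isRecordOfRecord₁₃CSepCoPOn_iff (D : FiniteEpsData F (SU N)) (w : WorldP) :
    IsRecordOfRecord₁₃CSepCoPOn F N Rg D w ↔ ∃ θ : Stage13Params F N, Rg F θ ∧ IsRateKey₁₃SepCoP F N D w θ :=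
  Iff.rfl

/-- **Every admissible θ in the regime with provisos is a record in the regime at some world with any window `0 < γw ≤ θ.γ`.** [cite: Balaban1989LargeFieldII, Thm 1 + (0.1) pp.355–356 (bookkeeping)] -/
theorem exists_world_isRecordOfRecord₁₃CSepCoPOn (θ : Stage13Params F N) (h : θ.Provisos₁₃SepCoP F N) (hRg : Rg F θ) (hθ : θ.Admissible F N) {γw : ℝ}
    (hγw : 0 < γw ∧ γw ≤ θ.γ) : ∃ w : WorldP, IsRecordOfRecord₁₃CSepCoPOn F N Rg (datumOfRecord₁₃SepCoP F N θ h) w ∧ w.γ = γw := by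
  obtain ⟨w, hk, hγ⟩ := exists_world_isRateKey₁₃SepCoP F N θ h hθ hγw
  exact ⟨w, ⟨θ, hRg, hk⟩, hγ⟩

/-- Some datum of record in the regime exists iff some record in the regime exists. [cite: Balaban1989LargeFieldII, Thm 1 + (0.1) pp.355–356 (bookkeeping)] -/
theorem exists_isDatumOfRecord₁₃CSepCoPOn_iff_exists_record :
    (∃ D : FiniteEpsData F (SU N), IsDatumOfRecord₁₃CSepCoPOn F N Rg D) ↔ ∃ (D : FiniteEpsData F (SU N)) (w : WorldP), IsRecordOfRecord₁₃CSepCoPOn F N Rg D w := by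
  constructor
  · rintro ⟨_, θ, hP, hRg, hθ, rfl⟩
    obtain ⟨w, hw, -⟩ := exists_world_isRecordOfRecord₁₃CSepCoPOn F N Rg θ hP hRg hθ ⟨hθ.toStage9.gamma_pos, le_rfl⟩
    exact ⟨_, w, hw⟩
  · rintro ⟨D, w, θ, hRg, hk⟩
    obtain ⟨hP, hθ, hD⟩ := hk.exists_provisos
    exact ⟨D, θ, hP, hRg, hθ, hD⟩

/-- **A WORLD-BLIND PROPERTY AT EVERY RECORD IN THE REGIME ⟺ THE θ-KEYED SENTENCE GUARDED BY `Rg`** — the junction between a composer's conclusion over the regime-restricted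
record class (e.g. `YMDAG.UVSplit.Spine` at `IsRecordOfRecord₁₃CSepCoPOn F N Rg`) and an item text «`∀ θ (h : θ.Provisos₁₃SepCoP F N), Rg F θ → θ.Admissible F N → P (datumOfRecord₁₃SepCoP F N θ h)`».
[cite: Balaban1989LargeFieldII, Thm 1 + (0.1) pp.355–356 (bookkeeping)] -/
theorem forall_isRecordOfRecord₁₃CSepCoPOn_iff (P : FiniteEpsData F (SU N) → Prop) :
    (∀ (D : FiniteEpsData F (SU N)) (w : WorldP), IsRecordOfRecord₁₃CSepCoPOn F N Rg D w → P D) ↔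
      ∀ (θ : Stage13Params F N) (h : θ.Provisos₁₃SepCoP F N), Rg F θ → θ.Admissible F N → P (datumOfRecord₁₃SepCoP F N θ h) := by
  constructor
  · intro hall θ h hRg hθ
    obtain ⟨w, hw, -⟩ := exists_world_isRecordOfRecord₁₃CSepCoPOn F N Rg θ h hRg hθ ⟨hθ.toStage9.gamma_pos, le_rfl⟩
    exact hall _ w hw
  · rintro hall D w ⟨θ, hRg, hk⟩
    obtain ⟨h, hθ, rfl⟩ := hk.exists_provisos
    exact hall θ h hRg hθ

variable {F N Rg}
variable {D : FiniteEpsData F (SU N)} {w : WorldP}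

/-- The regime forgotten: a record in the regime is a Stage-13 record. [cite: Balaban1989LargeFieldII, Thm 1 p.355 (bookkeeping)] -/
theorem IsRecordOfRecord₁₃CSepCoPOn.isRecordOfRecord₁₃CSepCoP (h : IsRecordOfRecord₁₃CSepCoPOn F N Rg D w) : IsRecordOfRecord₁₃CSepCoP F N D w := by
  obtain ⟨θ, -, hk⟩ := h
  exact hk.isRecordOfRecord₁₃CSepCoP

/-- Its datum is a datum of record in the regime. [cite: Balaban1989LargeFieldII, Thm 1 p.355 (bookkeeping)] -/
theorem IsRecordOfRecord₁₃CSepCoPOn.isDatumOfRecord₁₃CSepCoPOn (h : IsRecordOfRecord₁₃CSepCoPOn F N Rg D w) : IsDatumOfRecord₁₃CSepCoPOn F N Rg D := by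
  obtain ⟨θ, hRg, hk⟩ := h
  obtain ⟨hP, hθ, hD⟩ := hk.exists_provisos
  exact ⟨θ, hP, hRg, hθ, hD⟩

/-- **THE TUPLE IN THE REGIME BEHIND A RECORD IN THE REGIME** — exactly the hypothesis shape of the (T-RATE) home's `s_R00x_rRec₁₂On_of_regime` (to be re-keyed at ₁₃) («every record of `Rec` comes with
an admissible tuple with provisos in the regime realising `D`»): ONE application. [cite: Balaban1989LargeFieldII, Thm 1 + (0.1) pp.355–356 (bookkeeping)] -/
theorem IsRecordOfRecord₁₃CSepCoPOn.exists_regime_tuple (h : IsRecordOfRecord₁₃CSepCoPOn F N Rg D w) :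
    ∃ (θ : Stage13Params F N) (hP : θ.Provisos₁₃SepCoP F N), Rg F θ ∧ θ.Admissible F N ∧ D = datumOfRecord₁₃SepCoP F N θ hP :=
  h.isDatumOfRecord₁₃CSepCoPOn

/-- Monotone in the regime. [cite: Balaban1989LargeFieldII, Thm 1 p.355 (bookkeeping)] -/
theorem IsRecordOfRecord₁₃CSepCoPOn.mono {Rg' : (F : T4Family) → Stage13Params F N → Prop} (hle : ∀ (F : T4Family) (θ : Stage13Params F N), Rg F θ → Rg' F θ)
    (h : IsRecordOfRecord₁₃CSepCoPOn F N Rg D w) : IsRecordOfRecord₁₃CSepCoPOn F N Rg' D w := by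
  obtain ⟨θ, hRg, hk⟩ := h
  exact ⟨θ, hle F θ hRg, hk⟩

/-- The world's window is positive. [cite: Balaban1987RG1, Thm 1 p.259 (bookkeeping)] -/
theorem IsRecordOfRecord₁₃CSepCoPOn.gamma_pos (h : IsRecordOfRecord₁₃CSepCoPOn F N Rg D w) : 0 < w.γ := by
  obtain ⟨θ, -, hk⟩ := h
  exact hk.gamma_pos

/-- The world is bound to the datum's construction. [cite: Balaban1989LargeFieldII, Thm 1 + (0.1) pp.355–356 (bookkeeping)] -/
theorem IsRecordOfRecord₁₃CSepCoPOn.construction_eq (h : IsRecordOfRecord₁₃CSepCoPOn F N Rg D w) : w.C = D.C := by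
  obtain ⟨θ, -, hk⟩ := h
  exact hk.construction_eq

/-- A Stage-13 record keyed at a θ IN THE REGIME is a record in the regime (pointed intro). [cite: Balaban1989LargeFieldII, Thm 1 + (0.1) pp.355–356 (bookkeeping)] -/
theorem IsRateKey₁₃SepCoP.isRecordOfRecord₁₃CSepCoPOn {θ : Stage13Params F N} (hk : IsRateKey₁₃SepCoP F N D w θ) (hRg : Rg F θ) : IsRecordOfRecord₁₃CSepCoPOn F N Rg D w :=
  ⟨θ, hRg, hk⟩

/-- At the trivial regime the record key IS `IsRecordOfRecord₁₃CSepCoP`. [cite: Balaban1989LargeFieldII, Thm 1 p.355 (bookkeeping)] -/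
theorem isRecordOfRecord₁₃CSepCoPOn_true_iff : IsRecordOfRecord₁₃CSepCoPOn F N (fun _ _ => True) D w ↔ IsRecordOfRecord₁₃CSepCoP F N D w :=
  ⟨fun h => h.isRecordOfRecord₁₃CSepCoP, fun ⟨θ, hk⟩ => ⟨θ, trivial, hk⟩⟩

/-- **DATUM OF RECORD IN THE REGIME ⟺ RECORD IN THE REGIME AT SOME WORLD.** [cite: Balaban1989LargeFieldII, Thm 1 + (0.1) pp.355–356 (bookkeeping)] -/
theorem isDatumOfRecord₁₃CSepCoPOn_iff_exists_world : IsDatumOfRecord₁₃CSepCoPOn F N Rg D ↔ ∃ w : WorldP, IsRecordOfRecord₁₃CSepCoPOn F N Rg D w := by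
  constructor
  · rintro ⟨θ, hP, hRg, hθ, rfl⟩
    obtain ⟨w, hw, -⟩ := exists_world_isRecordOfRecord₁₃CSepCoPOn F N Rg θ hP hRg hθ ⟨hθ.toStage9.gamma_pos, le_rfl⟩
    exact ⟨w, hw⟩
  · rintro ⟨w, hw⟩
    exact hw.isDatumOfRecord₁₃CSepCoPOn

/-- **WORLD COMPANION IN THE REGIME AT ANY WINDOW BELOW THE CANONICAL ONE** (what an N17-type home-keying binder consumes once the U3 radius is pinned in `]0, h.params.γ]`).
[cite: Balaban1989LargeFieldII, Thm 1 + (0.1) pp.355–356 (bookkeeping)] -/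
theorem IsDatumOfRecord₁₃CSepCoPOn.exists_world (h : IsDatumOfRecord₁₃CSepCoPOn F N Rg D) {γw : ℝ} (hγw : 0 < γw ∧ γw ≤ h.params.γ) :
    ∃ w : WorldP, IsRecordOfRecord₁₃CSepCoPOn F N Rg D w ∧ w.γ = γw := by
  obtain ⟨w, hw, hγ⟩ := exists_world_isRecordOfRecord₁₃CSepCoPOn F N Rg h.params h.provisos h.regime h.admissible hγw
  exact ⟨w, h.eq_datumOfRecord₁₃SepCoP ▸ hw, hγ⟩

/-- … in particular at the canonical window itself. [cite: Balaban1989LargeFieldII, Thm 1 + (0.1) pp.355–356 (bookkeeping)] -/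
theorem IsDatumOfRecord₁₃CSepCoPOn.exists_world_gamma (h : IsDatumOfRecord₁₃CSepCoPOn F N Rg D) :
    ∃ w : WorldP, IsRecordOfRecord₁₃CSepCoPOn F N Rg D w ∧ w.γ = h.params.γ :=
  h.exists_world ⟨h.gamma_pos, le_rfl⟩

/-- The ₅C shadow at the canonical parameter in the regime (for consumers keyed at ₅C). [cite: Balaban1989LargeFieldII, Thm 1 + (0.1) pp.355–356 (bookkeeping)] -/
theorem IsDatumOfRecord₁₃CSepCoPOn.exists_isRecordOfRecord₅C (h : IsDatumOfRecord₁₃CSepCoPOn F N Rg D) :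
    ∃ (D₅ : FiniteEpsData F (SU N)) (w : WorldP), IsRecordOfRecord₅C F N D₅ w ∧ D₅.C = D.C ∧ (∀ K g₀ k, D₅.dens K g₀ k = D.dens K g₀ k) ∧
      D₅.βfun = D.βfun ∧ D₅.av = D.av :=
  h.toC.exists_isRecordOfRecord₅C

end RecordKeyOn

/-! ## §6. Canonicalised readings RELATIVE TO THE REGIME — coherence for regime homes keyed «`∃ θ hP, Rg F θ ∧ θ.Admissible F N ∧ D = datumOfRecord₁₃SepCoP F N θ hP ∧ S = cr F θ hP …`»

As `canon₁₃SepCoP` (gen 2) for the C key: reading a regime-keyed record through `canon₁₃SepCoPOn Rg f` makes the admitted bundle a function of the DATUM, read at the canonical parameter IN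
THE REGIME, so two regime homes read through `canon₁₃SepCoPOn Rg` admit, at the same `(F, D, g₀, os)`, bundles read at ONE parameter (`exists_keyed_canon₁₃SepCoPOn_iff`,
`keyed_canon₁₃SepCoPOn_coherent`).  Off the class `canon₁₃SepCoPOn Rg f = f`. -/
section CanonOn

variable (F : T4Family) (N : ℕ) [NeZero N] (Rg : (F : T4Family) → Stage13Params F N → Prop) {α : Sort*}

/-- **CANONICALISED READING RELATIVE TO THE REGIME**: read `f` at the canonical parameter in `Rg` of the datum `datumOfRecord₁₃SepCoP F N θ hP` when that datum is of record in the
regime, else at `(θ, hP)` itself.  Kernel bookkeeping (`Classical.dec`, `dite`). [cite: Balaban1989LargeFieldII, Thm 1 + (0.1) pp.355–356 (bookkeeping)] -/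
def canon₁₃SepCoPOn (f : (θ : Stage13Params F N) → θ.Provisos₁₃SepCoP F N → α) (θ : Stage13Params F N) (hP : θ.Provisos₁₃SepCoP F N) : α := by
  classical
  exact if h : IsDatumOfRecord₁₃CSepCoPOn F N Rg (datumOfRecord₁₃SepCoP F N θ hP) then f h.params h.provisos else f θ hP

variable {F N Rg}

/-- **`canon₁₃SepCoPOn Rg f θ hP = f h.params h.provisos`** whenever `(θ, hP)` realises a datum of record in the regime `D` with key `h`. [cite: Balaban1989LargeFieldII, Thm 1 + (0.1) pp.355–356 (bookkeeping)] -/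
theorem canon₁₃SepCoPOn_eq_of_eq {f : (θ : Stage13Params F N) → θ.Provisos₁₃SepCoP F N → α} {D : FiniteEpsData F (SU N)} (h : IsDatumOfRecord₁₃CSepCoPOn F N Rg D)
    (θ : Stage13Params F N) (hP : θ.Provisos₁₃SepCoP F N) (e : D = datumOfRecord₁₃SepCoP F N θ hP) :
    canon₁₃SepCoPOn F N Rg f θ hP = f h.params h.provisos := by
  subst e
  unfold canon₁₃SepCoPOn
  rw [dif_pos h]

/-- At the canonical parameter in the regime `canon₁₃SepCoPOn Rg f` reads `f`. [cite: Balaban1989LargeFieldII, Thm 1 + (0.1) pp.355–356 (bookkeeping)] -/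
theorem canon₁₃SepCoPOn_params {f : (θ : Stage13Params F N) → θ.Provisos₁₃SepCoP F N → α} {D : FiniteEpsData F (SU N)} (h : IsDatumOfRecord₁₃CSepCoPOn F N Rg D) :
    canon₁₃SepCoPOn F N Rg f h.params h.provisos = f h.params h.provisos :=
  canon₁₃SepCoPOn_eq_of_eq h h.params h.provisos h.eq_datumOfRecord₁₃SepCoP

/-- At an admissible tuple IN THE REGIME with provisos, `canon₁₃SepCoPOn Rg f` reads `f` at the canonical parameter in the regime of ITS datum. [cite: Balaban1989LargeFieldII, Thm 1 + (0.1) pp.355–356 (bookkeeping)] -/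
theorem canon₁₃SepCoPOn_eq_of_regime {f : (θ : Stage13Params F N) → θ.Provisos₁₃SepCoP F N → α} (θ : Stage13Params F N) (hP : θ.Provisos₁₃SepCoP F N) (hRg : Rg F θ)
    (hθ : θ.Admissible F N) :
    canon₁₃SepCoPOn F N Rg f θ hP = f (isDatumOfRecord₁₃CSepCoPOn_datumOfRecord₁₃SepCoP F N Rg θ hP hRg hθ).params (isDatumOfRecord₁₃CSepCoPOn_datumOfRecord₁₃SepCoP F N Rg θ hP hRg hθ).provisos :=
  canon₁₃SepCoPOn_eq_of_eq _ θ hP rfl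

/-- Off the class nothing is canonicalised. [cite: Balaban1989LargeFieldII, Thm 1 + (0.1) pp.355–356 (bookkeeping)] -/
theorem canon₁₃SepCoPOn_eq_self_of_not {f : (θ : Stage13Params F N) → θ.Provisos₁₃SepCoP F N → α} (θ : Stage13Params F N) (hP : θ.Provisos₁₃SepCoP F N)
    (hn : ¬ IsDatumOfRecord₁₃CSepCoPOn F N Rg (datumOfRecord₁₃SepCoP F N θ hP)) : canon₁₃SepCoPOn F N Rg f θ hP = f θ hP := by
  unfold canon₁₃SepCoPOn
  rw [dif_neg hn]

/-- **THE KEYED-RECORD FACE, IN THE REGIME**: a regime-keyed record read through `canon₁₃SepCoPOn Rg f` IS the datum-keyed record «the bundle reads `f` at the canonical parameter in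
the regime of `D`», for every property `Φ` of the reading. [cite: Balaban1989LargeFieldII, Thm 1 + (0.1) pp.355–356 (bookkeeping)] -/
theorem exists_keyed_canon₁₃SepCoPOn_iff {f : (θ : Stage13Params F N) → θ.Provisos₁₃SepCoP F N → α} {D : FiniteEpsData F (SU N)} (Φ : α → Prop) :
    (∃ (θ : Stage13Params F N) (hP : θ.Provisos₁₃SepCoP F N), Rg F θ ∧ θ.Admissible F N ∧ D = datumOfRecord₁₃SepCoP F N θ hP ∧ Φ (canon₁₃SepCoPOn F N Rg f θ hP)) ↔
      ∃ h : IsDatumOfRecord₁₃CSepCoPOn F N Rg D, Φ (f h.params h.provisos) := by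
  constructor
  · rintro ⟨θ, hP, hRg, hθ, e, hΦ⟩
    have h : IsDatumOfRecord₁₃CSepCoPOn F N Rg D := ⟨θ, hP, hRg, hθ, e⟩
    refine ⟨h, ?_⟩
    rwa [canon₁₃SepCoPOn_eq_of_eq (f := f) h θ hP e] at hΦ
  · rintro ⟨h, hΦ⟩
    refine ⟨h.params, h.provisos, h.regime, h.admissible, h.eq_datumOfRecord₁₃SepCoP, ?_⟩
    rwa [canon₁₃SepCoPOn_params (f := f) h]

/-- **COHERENCE IN THE REGIME**: two regime-keyed records read through `canon₁₃SepCoPOn Rg` admit, at the same datum, readings AT THE SAME PARAMETER.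
[cite: Balaban1989LargeFieldII, Thm 1 + (0.1) pp.355–356 (bookkeeping)] -/
theorem keyed_canon₁₃SepCoPOn_coherent {β : Sort*} {f : (θ : Stage13Params F N) → θ.Provisos₁₃SepCoP F N → α} {g : (θ : Stage13Params F N) → θ.Provisos₁₃SepCoP F N → β}
    {D : FiniteEpsData F (SU N)} (Φ : α → Prop) (Ψ : β → Prop)
    (hΦ : ∃ (θ : Stage13Params F N) (hP : θ.Provisos₁₃SepCoP F N), Rg F θ ∧ θ.Admissible F N ∧ D = datumOfRecord₁₃SepCoP F N θ hP ∧ Φ (canon₁₃SepCoPOn F N Rg f θ hP))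
    (hΨ : ∃ (θ : Stage13Params F N) (hP : θ.Provisos₁₃SepCoP F N), Rg F θ ∧ θ.Admissible F N ∧ D = datumOfRecord₁₃SepCoP F N θ hP ∧ Ψ (canon₁₃SepCoPOn F N Rg g θ hP)) :
    ∃ h : IsDatumOfRecord₁₃CSepCoPOn F N Rg D, Φ (f h.params h.provisos) ∧ Ψ (g h.params h.provisos) := by
  obtain ⟨h, h₁⟩ := (exists_keyed_canon₁₃SepCoPOn_iff Φ).1 hΦ
  obtain ⟨h', h₂⟩ := (exists_keyed_canon₁₃SepCoPOn_iff Ψ).1 hΨ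
  exact ⟨h, h₁, h₂⟩

end CanonOn

/-! ## §7. THE GUARD OF RECORD «partition of unity ∧ non-degenerate present slots» and the CN instances

The route's Stage-13 items (rev 16, to be minted) bundle `θ.ZtUnity F N` (print's partition of unity for the residual 𝐓-weights, [Balaban1988Convergent] (3.16)–(3.20)) and
`θ.SlotsNondegenerate₁₃ F N` (no present slot of record is the zero density, (3.22)) into ONE conjunction on the datum's own parameter.  Named once as a regime; the «CN key» is
§4–§6 at that regime. -/

section Guard

variable (F : T4Family) (N : ℕ) [NeZero N]


/-- **THE CN KEY — «`D` is a datum of record, Stage 13, realised by an admissible tuple WITH print's partition of unity AND non-degenerate present slots»**: the datum key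
at the guard of record. [cite: Balaban1989LargeFieldII, Thm 1 + (0.1) pp.355–356; Balaban1988Convergent, (3.16)–(3.22) pp.268–269 (objects of record; bookkeeping)] -/
abbrev IsDatumOfRecord₁₃CSepCoPN (D : FiniteEpsData F (SU N)) : Prop :=
  IsDatumOfRecord₁₃CSepCoPOn F N (unityNondeg₁₃ N) D

/-- **THE CN RECORD CLASS** at the guard of record. [cite: Balaban1989LargeFieldII, Thm 1 + (0.1) pp.355–356; Balaban1988Convergent, (3.16)–(3.22) pp.268–269 (objects of record; bookkeeping)] -/
abbrev IsRecordOfRecord₁₃CSepCoPN (D : FiniteEpsData F (SU N)) (w : WorldP) : Prop :=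
  IsRecordOfRecord₁₃CSepCoPOn F N (unityNondeg₁₃ N) D w

/-- **The CN key, literally**: SOME Stage-13 parameter tuple with provisos, `(θ.ZtUnity F N ∧ θ.SlotsNondegenerate₁₃ F N)`, admissible, has `D` as its datum of record (`Iff.rfl`).
[cite: Balaban1989LargeFieldII, Thm 1 + (0.1) pp.355–356; Balaban1988Convergent, (3.16)–(3.22) pp.268–269 (bookkeeping)] -/
theorem isDatumOfRecord₁₃CSepCoPN_iff (D : FiniteEpsData F (SU N)) :
    IsDatumOfRecord₁₃CSepCoPN F N D ↔
      ∃ (θ : Stage13Params F N) (h : θ.Provisos₁₃SepCoP F N), (θ.ZtUnity F N ∧ θ.SlotsNondegenerate₁₃ F N) ∧ θ.Admissible F N ∧ D = datumOfRecord₁₃SepCoP F N θ h :=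
  Iff.rfl

/-- **The CN record class, literally** (`Iff.rfl`). [cite: Balaban1989LargeFieldII, Thm 1 + (0.1) pp.355–356 (bookkeeping)] -/
theorem isRecordOfRecord₁₃CSepCoPN_iff (D : FiniteEpsData F (SU N)) (w : WorldP) :
    IsRecordOfRecord₁₃CSepCoPN F N D w ↔ ∃ θ : Stage13Params F N, (θ.ZtUnity F N ∧ θ.SlotsNondegenerate₁₃ F N) ∧ IsRateKey₁₃SepCoP F N D w θ :=
  Iff.rfl

/-- Intro at a guarded admissible tuple with provisos. [cite: Balaban1989LargeFieldII, Thm 1 + (0.1) pp.355–356 (bookkeeping)] -/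
theorem isDatumOfRecord₁₃CSepCoPN_datumOfRecord₁₃SepCoP (θ : Stage13Params F N) (h : θ.Provisos₁₃SepCoP F N) (hG : θ.ZtUnity F N ∧ θ.SlotsNondegenerate₁₃ F N) (hθ : θ.Admissible F N) :
    IsDatumOfRecord₁₃CSepCoPN F N (datumOfRecord₁₃SepCoP F N θ h) :=
  isDatumOfRecord₁₃CSepCoPOn_datumOfRecord₁₃SepCoP F N _ θ h hG hθ

/-- **K0′ READS THE SAME AT THE CN DATUM**: some CN datum of record exists at `(F, N)` iff SOME Stage-13 parameter tuple satisfies every displayed proviso, print's partition of unity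
and non-degeneracy of the present slots, and is admissible — the body of the route's `Record12Inhabited` (rev 15) at `(F, N)`, verbatim; inhabitation is NOT claimed here.
[cite: Balaban1988Convergent, (2.7) p.255, (2.21) p.258, (2.28) p.259, (3.16)–(3.22) pp.268–269; Balaban1987RG1, (1.12)–(1.15) p.262 (hypothesis dictionary; bookkeeping)] -/
theorem exists_isDatumOfRecord₁₃CSepCoPN_iff_exists_params :
    (∃ D : FiniteEpsData F (SU N), IsDatumOfRecord₁₃CSepCoPN F N D) ↔
      ∃ θ : Stage13Params F N, θ.Provisos₁₃SepCoP F N ∧ (θ.ZtUnity F N ∧ θ.SlotsNondegenerate₁₃ F N) ∧ θ.Admissible F N :=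
  exists_isDatumOfRecord₁₃CSepCoPOn_iff_exists_params F N _

/-- … and iff some CN record exists. [cite: Balaban1989LargeFieldII, Thm 1 + (0.1) pp.355–356 (bookkeeping)] -/
theorem exists_isRecordOfRecord₁₃CSepCoPN_iff_exists_params :
    (∃ (D : FiniteEpsData F (SU N)) (w : WorldP), IsRecordOfRecord₁₃CSepCoPN F N D w) ↔
      ∃ θ : Stage13Params F N, θ.Provisos₁₃SepCoP F N ∧ (θ.ZtUnity F N ∧ θ.SlotsNondegenerate₁₃ F N) ∧ θ.Admissible F N :=
  (exists_isDatumOfRecord₁₃CSepCoPOn_iff_exists_record F N _).symm.trans (exists_isDatumOfRecord₁₃CSepCoPN_iff_exists_params F N)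

/-- **THE K2′ ∕ K3′ JUNCTION**: a world-blind property at EVERY CN record ⟺ the θ-keyed sentence «`∀ θ (h : θ.Provisos₁₃SepCoP F N), (θ.ZtUnity F N ∧ θ.SlotsNondegenerate₁₃ F N) →
θ.Admissible F N → P (datumOfRecord₁₃SepCoP F N θ h)`» — the items' binder prefix (what a `Spine` ∕ endpoint composer over the CN record class reads the text off).
[cite: Balaban1989LargeFieldII, Thm 1 + (0.1) pp.355–356 (bookkeeping)] -/
theorem forall_isRecordOfRecord₁₃CSepCoPN_iff (P : FiniteEpsData F (SU N) → Prop) :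
    (∀ (D : FiniteEpsData F (SU N)) (w : WorldP), IsRecordOfRecord₁₃CSepCoPN F N D w → P D) ↔
      ∀ (θ : Stage13Params F N) (h : θ.Provisos₁₃SepCoP F N), (θ.ZtUnity F N ∧ θ.SlotsNondegenerate₁₃ F N) → θ.Admissible F N → P (datumOfRecord₁₃SepCoP F N θ h) :=
  forall_isRecordOfRecord₁₃CSepCoPOn_iff F N _ P

/-- … datum-level form. [cite: Balaban1989LargeFieldII, Thm 1 + (0.1) pp.355–356 (bookkeeping)] -/
theorem forall_isDatumOfRecord₁₃CSepCoPN_iff (P : FiniteEpsData F (SU N) → Prop) :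
    (∀ D : FiniteEpsData F (SU N), IsDatumOfRecord₁₃CSepCoPN F N D → P D) ↔
      ∀ (θ : Stage13Params F N) (h : θ.Provisos₁₃SepCoP F N), (θ.ZtUnity F N ∧ θ.SlotsNondegenerate₁₃ F N) → θ.Admissible F N → P (datumOfRecord₁₃SepCoP F N θ h) :=
  forall_isDatumOfRecord₁₃CSepCoPOn_iff F N _ P

/-- Every guarded admissible θ with provisos is a CN record at some world with any window `0 < γw ≤ θ.γ`. [cite: Balaban1989LargeFieldII, Thm 1 + (0.1) pp.355–356 (bookkeeping)] -/
theorem exists_world_isRecordOfRecord₁₃CSepCoPN (θ : Stage13Params F N) (h : θ.Provisos₁₃SepCoP F N) (hG : θ.ZtUnity F N ∧ θ.SlotsNondegenerate₁₃ F N) (hθ : θ.Admissible F N)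
    {γw : ℝ} (hγw : 0 < γw ∧ γw ≤ θ.γ) : ∃ w : WorldP, IsRecordOfRecord₁₃CSepCoPN F N (datumOfRecord₁₃SepCoP F N θ h) w ∧ w.γ = γw :=
  exists_world_isRecordOfRecord₁₃CSepCoPOn F N _ θ h hG hθ hγw

variable {F N}
variable {D : FiniteEpsData F (SU N)} {w : WorldP}

/-- **THE GUARD AT THE CANONICAL CN PARAMETER** — the one thing the C key cannot supply. [cite: Balaban1988Convergent, (3.16)–(3.22) pp.268–269 (bookkeeping)] -/
theorem IsDatumOfRecord₁₃CSepCoPN.guard (h : IsDatumOfRecord₁₃CSepCoPN F N D) : h.params.ZtUnity F N ∧ h.params.SlotsNondegenerate₁₃ F N :=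
  h.regime

/-- Print's partition of unity at the canonical CN parameter. [cite: Balaban1988Convergent, (3.16)–(3.20) pp.268–269 (bookkeeping)] -/
theorem IsDatumOfRecord₁₃CSepCoPN.ztUnity (h : IsDatumOfRecord₁₃CSepCoPN F N D) : h.params.ZtUnity F N :=
  h.regime.1

/-- Non-degeneracy of the present slots at the canonical CN parameter. [cite: Balaban1988Convergent, (3.22) p.269 (bookkeeping)] -/
theorem IsDatumOfRecord₁₃CSepCoPN.slotsNondegenerate (h : IsDatumOfRecord₁₃CSepCoPN F N D) : h.params.SlotsNondegenerate₁₃ F N :=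
  h.regime.2

/-- **WHAT A CONSUMER PROVES UNDER THE GUARD ⟹ WHAT THE CN INSTANCE CARRIES** (the items' binder order: guard, then admissibility). [cite: Balaban1989LargeFieldII, Thm 1 p.355 (bookkeeping)] -/
theorem IsDatumOfRecord₁₃CSepCoPN.forall_params {P : (D : FiniteEpsData F (SU N)) → (θ : Stage13Params F N) → θ.Provisos₁₃SepCoP F N → Prop}
    (hP : ∀ (θ : Stage13Params F N) (hθ : θ.Provisos₁₃SepCoP F N), (θ.ZtUnity F N ∧ θ.SlotsNondegenerate₁₃ F N) → θ.Admissible F N → P (datumOfRecord₁₃SepCoP F N θ hθ) θ hθ)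
    (h : IsDatumOfRecord₁₃CSepCoPN F N D) : P D h.params h.provisos :=
  IsDatumOfRecord₁₃CSepCoPOn.forall_params hP h

/-- A CN datum is a C datum (the guard forgotten; its C-canonical parameter is NOT asserted to satisfy the guard). [cite: Balaban1989LargeFieldII, Thm 1 p.355 (bookkeeping)] -/
theorem IsDatumOfRecord₁₃CSepCoPN.isDatumOfRecord₁₃CSepCoP (h : IsDatumOfRecord₁₃CSepCoPN F N D) : IsDatumOfRecord₁₃CSepCoP F N D :=
  h.toC

/-- A CN record is a Stage-13 record. [cite: Balaban1989LargeFieldII, Thm 1 p.355 (bookkeeping)] -/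
theorem IsRecordOfRecord₁₃CSepCoPN.isRecordOfRecord₁₃CSepCoP' (h : IsRecordOfRecord₁₃CSepCoPN F N D w) : IsRecordOfRecord₁₃CSepCoP F N D w :=
  h.isRecordOfRecord₁₃CSepCoP

/-- The guarded tuple behind a CN record (feeds the ₁₃ re-key of `s_R00x_rRec₁₂On_of_regime 𝔯 ·` at `unityNondeg₁₃ N` in one application). [cite: Balaban1989LargeFieldII, Thm 1 + (0.1) pp.355–356 (bookkeeping)] -/
theorem IsRecordOfRecord₁₃CSepCoPN.exists_guarded_tuple (h : IsRecordOfRecord₁₃CSepCoPN F N D w) :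
    ∃ (θ : Stage13Params F N) (hP : θ.Provisos₁₃SepCoP F N), (θ.ZtUnity F N ∧ θ.SlotsNondegenerate₁₃ F N) ∧ θ.Admissible F N ∧ D = datumOfRecord₁₃SepCoP F N θ hP :=
  h.exists_regime_tuple

/-- A datum of record whose C-canonical parameter satisfies the guard is a CN datum. [cite: Balaban1989LargeFieldII, Thm 1 p.355 (bookkeeping)] -/
theorem IsDatumOfRecord₁₃CSepCoP.isDatumOfRecord₁₃CSepCoPN_of_guard (h : IsDatumOfRecord₁₃CSepCoP F N D) (hG : h.params.ZtUnity F N ∧ h.params.SlotsNondegenerate₁₃ F N) :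
    IsDatumOfRecord₁₃CSepCoPN F N D :=
  h.isDatumOfRecord₁₃CSepCoPOn_of_regime_params hG

end Guard

/-! ## §8. THE ONE-WAY BRIDGE INTO THE `CoP` KEYS (`Node00/Record13DatumKeyCoP`, provisos `Provisos₁₃Core`): by def-T's `Stage13Params.Provisos₁₃SepCoP.toCore` and the
definitional agreement of the two data of record (def-T's `datumOfRecord₁₃SepCoP_eq_coP`, `rfl`), every datum ∕ record keyed on the provisos of this module (`Provisos₁₃SepCoP`) is keyed on `Provisos₁₃Core`
AT THE SAME DATUM AND PARAMETER; NOT conversely (a `CoP` record asserts no background-field bound), and there is NO bridge to or from the ‴ ∕ ⁗ ∕ `SepMixed` keys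
(their data read another background object). -/

section BridgeToCoP

variable {F : T4Family} {N : ℕ} [NeZero N]
variable {D : FiniteEpsData F (SU N)} {w : WorldP} {Rg : (F : T4Family) → Stage13Params F N → Prop} {θ : Stage13Params F N}

/-- The θ-exposed `SepCoP` key gives the `CoP` one (same θ). [cite: Balaban1989LargeFieldII, Thm 1 + (0.1) pp.355–356 (bookkeeping)] -/
theorem IsRateKey₁₃SepCoP.toCoP (h : IsRateKey₁₃SepCoP F N D w θ) : IsRateKey₁₃CoP F N D w θ := by
  obtain ⟨hP, hθ, hD, hrest⟩ := h
  exact ⟨hP.toCore, hθ, hD, hrest⟩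

/-- A `SepCoP`-keyed datum of record is a `CoP`-keyed datum of record. [cite: Balaban1989LargeFieldII, Thm 1 + (0.1) pp.355–356 (bookkeeping)] -/
theorem IsDatumOfRecord₁₃CSepCoP.toCoP (h : IsDatumOfRecord₁₃CSepCoP F N D) : IsDatumOfRecord₁₃CCoP F N D := by
  obtain ⟨θ, hP, hθ, hD⟩ := h
  exact ⟨θ, hP.toCore, hθ, hD⟩

/-- … in every regime. [cite: Balaban1989LargeFieldII, Thm 1 + (0.1) pp.355–356 (bookkeeping)] -/
theorem IsDatumOfRecord₁₃CSepCoPOn.toCoP (h : IsDatumOfRecord₁₃CSepCoPOn F N Rg D) : IsDatumOfRecord₁₃CCoPOn F N Rg D := by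
  obtain ⟨θ, hP, hR, hθ, hD⟩ := h
  exact ⟨θ, hP.toCore, hR, hθ, hD⟩

/-- … and for records in every regime. [cite: Balaban1989LargeFieldII, Thm 1 + (0.1) pp.355–356 (bookkeeping)] -/
theorem IsRecordOfRecord₁₃CSepCoPOn.toCoP (h : IsRecordOfRecord₁₃CSepCoPOn F N Rg D w) : IsRecordOfRecord₁₃CCoPOn F N Rg D w := by
  obtain ⟨θ, hR, hk⟩ := h
  exact ⟨θ, hR, hk.toCoP⟩

/-- … at the guard of record. [cite: Balaban1988Convergent, (3.16)–(3.22) pp.268–269 (bookkeeping)] -/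
theorem IsDatumOfRecord₁₃CSepCoPN.toCoP (h : IsDatumOfRecord₁₃CSepCoPN F N D) : IsDatumOfRecord₁₃CCoPN F N D :=
  IsDatumOfRecord₁₃CSepCoPOn.toCoP h

/-- … at the guard of record, records. [cite: Balaban1988Convergent, (3.16)–(3.22) pp.268–269 (bookkeeping)] -/
theorem IsRecordOfRecord₁₃CSepCoPN.toCoP (h : IsRecordOfRecord₁₃CSepCoPN F N D w) : IsRecordOfRecord₁₃CCoPN F N D w :=
  IsRecordOfRecord₁₃CSepCoPOn.toCoP h

end BridgeToCoP

end Literature.MathematicalPhysics.QuantumFieldTheory.Balaban1983to89.Node00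

end
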